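import Literature.Analysis.FluidPDE.OseenDuhamelMeasurable
import Literature.Analysis.FluidPDE.KNSSRegularityGalilean
import Literature.Analysis.FluidPDE.OseenHeatCommute
import Literature.Analysis.FluidPDE.WeakGradientIBP
import HarnessLib

/-!
# KNSS 2009, §4: Galilean covariance of the drift-mild class — proof

Analysis/FluidPDE proofs file (everything proved; no named facts) discharging the named
proposition `Literature.Analysis.FluidPDE.IsKNSSDriftMild.GalileanCovariance` of
`KNSSRegularityGalilean.lean` in dimension three
(`IsKNSSDriftMild.galileanCovariance_of_finrank_eq_three`, `IsKNSSDriftMild.galileanCovariance_R3`):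
if `(U, b)` is drift-mild on `(0, T)` with bound `N` (`IsKNSSDriftMild T N U b`,
`KNSSRegularityDecomposition.lean`: the output of Lemma 3.1 of Koch–Nadirashvili–Seregin–Šverák
2009 for a bounded weak solution `u = U + b(t)`), then the co-moving field
`Ū(t, y) = U(t, y + B(t))`, `B = ∫₀ b` (`galileanShift U b`), satisfies the **zero-drift**
identity `Ū(t) = e^{(t−s)Δ}Ū(s) − ∫ₛᵗ e^{(t−σ)Δ}P∇·(Ū⊗Ū)(σ) dσ`, `0 < s < t < T`, pointwise —
it is a bounded mild solution of Navier–Stokes. Consequently the Galilean hypothesis of the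
reduction `KNSS2009_driftMild_regularity_of_mild` is discharged
(`KNSS2009_driftMild_regularity_of_mild'`), and the ancient regularity fact
`KNSS2009_regularity_boundedWeak_ancient` (the §4 input "by the results of Section 4" of the proofs
of Theorems 5.2–5.3) now rests on exactly two named facts: Lemma 3.1 in drift-mild form
(`KNSS2009_weak_driftMild`) and the regularity of bounded mild solutions
(`KNSS2009_mild_regularity`, i.e. KNSS's Proposition 4.1 with (4.6) and (4.8))
(`KNSS2009_regularity_boundedWeak_ancient_of_mild'`).

## The proof

Write `𝒩_τ = e^{τΔ}P∇·` for the tree's `oseenHeat τ` and `Φ(σ) = e^{(t−σ)Δ}U(σ)` (`σ < t`).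

1. **Linearity of `𝒩_τ` on bounded matrix fields** (`oseenHeat_add_of_top`,
   `oseenHeat_const_mul_of_top`; three `D¹` layers `heatD3_eq_heatD1_heatD1_heatD1`) and
   `𝒩_τ[const] = 0` (`oseenHeat_const`).
2. **`div e^{sΔ}U = 0` for bounded weakly divergence-free `U`** (`sum_heatD1_inner_eq_zero`:
   `∑ⱼ ∂ⱼe^{sΔ}Uⱼ(x) = ∫ DG_s(w)[U(x − w)] dw = −∫ D_y[G_s(x − y)](U(y)) dy = 0`, the weak condition
   extended to the Gaussian test by the tree's `IsWeaklyDivFree.integral_fderiv_apply_eq_zero`).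
3. **Drift algebra** (`oseenHeat_driftTensor_eq`): for a constant vector `c`,
   `𝒩_τ[(U+c)⊗(U+c)]ᵢ = 𝒩_τ[U⊗U]ᵢ + ∂_c e^{τΔ}Uᵢ` — `c⊗c` is constant, `U⊗c` is killed by 2
   (`oseenHeat_inner_mul_const_eq_zero`, with Schwarz symmetry `heatD2_comm_of_top` for the Leray
   correction), `c⊗U` gives the transport term (`oseenHeat_const_mul_inner_eq`). In vector form,
   at a.e. time of the window (`IsKNSSDriftMild.sum_oseenHeat_driftTensor_smul_eq`):
   `𝒩_{t−ρ}[(U+b)⊗(U+b)](ρ) = 𝒩_{t−ρ}[U⊗U](ρ) + D(e^{(t−ρ)Δ}U(ρ))[b(ρ)]`.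
4. **Restart** (`IsKNSSDriftMild.heatExtension_slice_eq`, from the drift-mild identity at
   `(s, σ)`, the heat semigroup law and the tree's `heatExtension_integral_sum_oseenHeat_duhamel`),
   whence (`…_sub_integral`, `…_sub_eq`) `Φ(σ') − Φ(σ) = −∫_σ^{σ'} (𝒩_{t−ρ}[U⊗U](ρ) + DΦ(ρ)[b(ρ)]) dρ`.
5. **Continuity** of `(ρ, z) ↦ 𝒩_{t−ρ}[U⊗U](ρ)(z)` and `(ρ, z) ↦ DΦ(ρ)(z)` on
   `(0, min(t,T)) × E` (`continuousOn_pureDuhamelIntegrand`, `continuousOn_fderiv_heatExtension_slice`),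
   from the Hölder-`1/2` sup-norm time continuity of drift-mild slices
   (`IsKNSSDriftMild.norm_slice_sub_slice_le`: the tree's Hölder modulus of the Duhamel integral
   `norm_integral_sum_oseenHeat_duhamel_sub_le` plus the time modulus of the heat flow on bounded
   data away from `t = 0`, `norm_heatExtension_sub_heatExtension_le_of_bound`), the Lipschitz
   dependence `L^∞ → L^∞` of `𝒩_τ` on the data and the tree's moduli in the clock
   (`norm_oseenHeat_sub_le`, and `norm_heatD1_sub_heatD1_le_of_top` here).
6. **The moving frame** (`IsKNSSDriftMild.hasDerivAt_movingFrame`): along the Lipschitz frame path,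
   `Ψ(σ) = Φ(σ)(y + B(σ))` is differentiable at every `σ ∈ (s₀, t)` with
   `Ψ'(σ) = −𝒩_{t−σ}[U⊗U](σ)(y + B(σ))` — the transport terms of 4 cancel against the displacement
   `B(σ') − B(σ) = ∫_σ^{σ'} b` through `DΦ(σ)`, by 5 and differentiability of the slice; no
   differentiability of `B` is used. Integrating over `[s, t']` and letting `t' ↑ t`
   (`‖driftDuhamel U b t' t‖ ≤ C N²(t − t')^{1/2}`, continuity of `U(t, ·)`, integrable weight
   `(t−σ)^{-1/2}`) gives `U(t, y + B(t)) = e^{(t−s)Δ}U(s)(y + B(s)) − ∫ₛᵗ 𝒩_{t−σ}[U⊗U](σ)(y + B(σ)) dσ`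
   (`IsKNSSDriftMild.apply_add_driftPath_eq`).
7. **Translation covariance** of `e^{τΔ}` and `𝒩_τ` (`heatExtension_comp_add_right_apply`,
   `oseenHeat_comp_add_right`, exact) turns 6 into the zero-drift identity for `Ū`; the other
   clauses of `IsKNSSDriftMild T N Ū 0` are translation invariance of the bound, of joint
   measurability (measurable shear) and of weak divergence-freeness.

## Mathlib / tree search

Tree: `OseenHeat`/`OseenHeatSemigroup`/`OseenHeatCommute` (`heatD1/2/3`, `oseenHeat`,
`heatD3_eq_heatD1_heatD1_heatD1`, `heatD2_eq_heatD1_heatD1`, `heatExtension_add_of_top`,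
`integrableOn_heatD3_const_add_of_top`, `norm_oseenHeat_le_of_top`, `norm_oseenHeat_sub_le`,
`contDiff_oseenHeat`, `heatExtension_heatD1`, `norm_heatD1_le_of_top`, `fderiv_fderiv_apply_comm`);
`OseenDuhamelMeasurable` (`IsKNSSDriftMild.continuous_slice/…memLp_top_slice/…norm_driftDuhamel_le/
…continuous_driftDuhamel/…abs_driftTensor_le/…measurable_driftTensor`,
`heatExtension_integral_sum_oseenHeat_duhamel`, `norm_integral_sum_oseenHeat_duhamel_sub_le`,
`intervalIntegrable_sum_oseenHeat_sub_smul_of_le`, `norm_sum_oseenHeat_duhamelIntegrand_smul_le`,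
`norm_sum_smul_stdOrthonormalBasis_le`, `abs_inner_stdOrthonormalBasis_le`);
`HeatKernelBoundedData` (`norm_fderiv_heatExtension_le_of_bounded`,
`norm_heatExtension_sub_self_le_of_holder`, `heatExtension_sub_of_bound`, `heatExtension_const`,
`heatExtension_const_smul`), `HeatKernelHeatEquation` (`norm_heatExtension_le`),
`WeakGradientIBP` (`IsWeaklyDivFree.integral_fderiv_apply_eq_zero`), `KNSSRegularityGalilean`
(`driftPath`, `galileanShift`, `driftPath_sub`, `norm_driftPath_sub_le`, `continuous_driftPath`,
`intervalIntegrable_of_norm_le`, `fderiv_comp_sub_right`). Mathlib: `integral_inner`,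
`Measure.measurePreserving_sub_left`, `integral_sub_left_eq_self`, `OrthonormalBasis.sum_repr'`,
`IsCompact.uniformContinuousOn_of_continuous`, `intervalIntegral.integral_eq_sub_of_hasDerivAt`,
`intervalIntegral.continuousOn_primitive_interval'`, `nhdsWithin_Ioo_eq_nhdsLT`,
`tendsto_nhds_unique`, `HasCompactSupport.comp_homeomorph`.

## References

* G. Koch, N. Nadirashvili, G. Seregin, V. Šverák, *Liouville theorems for the Navier–Stokes
  equations and applications*, Acta Math. 203 (2009) 83–105 = arXiv:0709.3599v1: §1 p. 3
  (parasitic solutions `u = b(t)`), §3 Lemma 3.1 and Remark 3.1 (p. 7), §4 (i)–(ii),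
  (4.3)–(4.4), Proposition 4.1 and the closing paragraph (p. 8). [KochNadirashviliSereginSverak2009]
* A. J. Majda, A. L. Bertozzi, *Vorticity and Incompressible Flow* (CUP 2002), §1.2 (Galilean
  invariance). [MajdaBertozziCUP2002]
* P. G. Lemarié-Rieusset, *The Navier–Stokes Problem in the 21st Century*, CRC 2016, §6.2 and
  Cor. 6.2 (`div e^{tΔ}u₀ = e^{tΔ} div u₀`). [LemarieRieusset2016]
-/

noncomputable section

open MeasureTheory Set Function Filter TopologicalSpace InnerProductSpace Metric
open _root_.Topology
open scoped RealInnerProductSpace Laplacian ContDiff NNReal ENNReal Interval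

namespace Literature.Analysis.FluidPDE

/-! ### Linearity of the heat-flow derivatives and of the Oseen–heat operator on bounded data -/

section OseenAlgebra

variable {E : Type*} [NormedAddCommGroup E] [InnerProductSpace ℝ E] [FiniteDimensional ℝ E]
  [MeasurableSpace E] [BorelSpace E]

variable {φ ψ : E → ℝ}

/-- The caloric extension of `L^∞` data is smooth (wrapper). [folklore] -/
theorem differentiable_heatExtension_of_top (hφ : MemLp φ ∞ volume) {s : ℝ} (hs : 0 < s) :
    Differentiable ℝ (UnboundedOperators.heatExtension φ s) :=
  (UnboundedOperators.contDiff_heatExtension_holds hφ le_top hs).differentiable (by simp)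

/-- Additivity of the caloric extension on `L^∞` data, as functions. [folklore] -/
theorem heatExtension_add_of_top' (hφ : MemLp φ ∞ volume) (hψ : MemLp ψ ∞ volume) {s : ℝ}
    (hs : 0 < s) :
    UnboundedOperators.heatExtension (φ + ψ) s =
      UnboundedOperators.heatExtension φ s + UnboundedOperators.heatExtension ψ s :=
  funext fun x => heatExtension_add_of_top hφ hψ hs x

/-- Homogeneity of the caloric extension, as functions. [folklore] -/
theorem heatExtension_const_mul' (a : ℝ) (φ : E → ℝ) (s : ℝ) :
    UnboundedOperators.heatExtension (fun z => a * φ z) s =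
      fun x => a * UnboundedOperators.heatExtension φ s x :=
  funext fun x => by
    simpa [smul_eq_mul] using UnboundedOperators.heatExtension_const_smul a φ s x

/-- `∂ᵥ e^{sΔ}(φ + ψ) = ∂ᵥ e^{sΔ}φ + ∂ᵥ e^{sΔ}ψ` for bounded data. [folklore] -/
theorem heatD1_add_of_top (hφ : MemLp φ ∞ volume) (hψ : MemLp ψ ∞ volume) {s : ℝ} (hs : 0 < s)
    (v x : E) : heatD1 s v (φ + ψ) x = heatD1 s v φ x + heatD1 s v ψ x := by
  unfold heatD1
  rw [heatExtension_add_of_top' hφ hψ hs,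
    fderiv_add (differentiable_heatExtension_of_top hφ hs x)
      (differentiable_heatExtension_of_top hψ hs x)]
  rfl

/-- `∂ᵥ e^{sΔ}(a φ) = a ∂ᵥ e^{sΔ}φ`. [folklore] -/
theorem heatD1_const_mul (a : ℝ) (φ : E → ℝ) (s : ℝ) (v x : E) :
    heatD1 s v (fun z => a * φ z) x = a * heatD1 s v φ x := by
  unfold heatD1
  rw [heatExtension_const_mul' a φ s]
  rw [show (fun x => a * UnboundedOperators.heatExtension φ s x) =
      a • UnboundedOperators.heatExtension φ s from rfl, fderiv_const_smul_field]
  rfl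

/-- `∂ᵥ e^{sΔ} c = 0` for a constant. [folklore] -/
theorem heatD1_const (c : ℝ) {s : ℝ} (hs : 0 < s) (v x : E) :
    heatD1 s v (fun _ : E => c) x = 0 := by
  unfold heatD1
  have h : UnboundedOperators.heatExtension (fun _ : E => c) s = fun _ => c :=
    funext fun y => UnboundedOperators.heatExtension_const c hs y
  rw [h]
  simp

/-- `heatD1` of bounded data is bounded (`L^∞`) (wrapper of `memLp_heatD1`). [folklore] -/
theorem memLp_top_heatD1' (hφ : MemLp φ ∞ volume) {s : ℝ} (hs : 0 < s) (v : E) :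
    MemLp (heatD1 s v φ) ∞ volume :=
  memLp_heatD1 hφ le_top hs v

/-- `∂³ e^{sΔ}(φ + ψ) = ∂³ e^{sΔ}φ + ∂³ e^{sΔ}ψ` for bounded data (three `D¹` layers). [folklore] -/
theorem heatD3_add_of_top (hφ : MemLp φ ∞ volume) (hψ : MemLp ψ ∞ volume) {s : ℝ} (hs : 0 < s)
    (u v w x : E) : heatD3 s u v w (φ + ψ) x = heatD3 s u v w φ x + heatD3 s u v w ψ x := by
  have h3 : 0 < s / 3 := by positivity
  have e : s = s / 3 + s / 3 + s / 3 := by ring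
  rw [e, heatD3_eq_heatD1_heatD1_heatD1 (hφ.add hψ) le_top h3 h3 h3,
    heatD3_eq_heatD1_heatD1_heatD1 hφ le_top h3 h3 h3,
    heatD3_eq_heatD1_heatD1_heatD1 hψ le_top h3 h3 h3]
  have h1 : heatD1 (s / 3) w (φ + ψ) = heatD1 (s / 3) w φ + heatD1 (s / 3) w ψ :=
    funext fun y => heatD1_add_of_top hφ hψ h3 w y
  rw [h1]
  have h2 : heatD1 (s / 3) v (heatD1 (s / 3) w φ + heatD1 (s / 3) w ψ) =
      heatD1 (s / 3) v (heatD1 (s / 3) w φ) + heatD1 (s / 3) v (heatD1 (s / 3) w ψ) :=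
    funext fun y => heatD1_add_of_top (memLp_top_heatD1' hφ h3 w) (memLp_top_heatD1' hψ h3 w) h3 v y
  rw [h2]
  exact heatD1_add_of_top (memLp_top_heatD1' (memLp_top_heatD1' hφ h3 w) h3 v)
    (memLp_top_heatD1' (memLp_top_heatD1' hψ h3 w) h3 v) h3 u x

/-- `∂³ e^{sΔ}(a φ) = a ∂³ e^{sΔ}φ` for bounded data. [folklore] -/
theorem heatD3_const_mul (hφ : MemLp φ ∞ volume) (a : ℝ) {s : ℝ} (hs : 0 < s) (u v w x : E) :
    heatD3 s u v w (fun z => a * φ z) x = a * heatD3 s u v w φ x := by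
  have h3 : 0 < s / 3 := by positivity
  have e : s = s / 3 + s / 3 + s / 3 := by ring
  have hφa : MemLp (fun z => a * φ z) ∞ volume := hφ.const_mul a
  rw [e, heatD3_eq_heatD1_heatD1_heatD1 hφa le_top h3 h3 h3,
    heatD3_eq_heatD1_heatD1_heatD1 hφ le_top h3 h3 h3]
  have h1 : heatD1 (s / 3) w (fun z => a * φ z) = fun y => a * heatD1 (s / 3) w φ y :=
    funext fun y => heatD1_const_mul a φ _ w y
  rw [h1]
  have h2 : heatD1 (s / 3) v (fun y => a * heatD1 (s / 3) w φ y) =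
      fun y => a * heatD1 (s / 3) v (heatD1 (s / 3) w φ) y :=
    funext fun y => heatD1_const_mul a _ _ v y
  rw [h2, heatD1_const_mul]

/-- `∂³ e^{sΔ} c = 0` for a constant. [folklore] -/
theorem heatD3_const (c : ℝ) {s : ℝ} (hs : 0 < s) (u v w x : E) :
    heatD3 s u v w (fun _ : E => c) x = 0 := by
  have h3 : 0 < s / 3 := by positivity
  have e : s = s / 3 + s / 3 + s / 3 := by ring
  rw [e, heatD3_eq_heatD1_heatD1_heatD1 (memLp_top_const c) le_top h3 h3 h3]
  have h1 : heatD1 (s / 3) w (fun _ : E => c) = fun _ => 0 := funext fun y => heatD1_const c h3 w y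
  rw [h1]
  have h2 : heatD1 (s / 3) v (fun _ : E => (0 : ℝ)) = fun _ => 0 := funext fun y => heatD1_const 0 h3 v y
  rw [h2, heatD1_const 0 h3]

variable (hE : Module.finrank ℝ E = 3)
include hE

variable {F G : Fin (Module.finrank ℝ E) → Fin (Module.finrank ℝ E) → E → ℝ}

/-- **Additivity of `𝒩_τ = e^{τΔ}P∇·` on bounded matrix fields** (dimension three, where the
Leray correction integral converges absolutely by `integrableOn_heatD3_const_add_of_top`). [folklore] -/
theorem oseenHeat_add_of_top (hF : ∀ j k, MemLp (F j k) ∞ volume) (hG : ∀ j k, MemLp (G j k) ∞ volume)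
    {τ : ℝ} (hτ : 0 < τ) (i : Fin (Module.finrank ℝ E)) (x : E) :
    oseenHeat τ (fun j k => F j k + G j k) i x = oseenHeat τ F i x + oseenHeat τ G i x := by
  unfold oseenHeat
  set b := stdOrthonormalBasis ℝ E
  have h1 : ∀ j, heatD1 τ (b j) (F j i + G j i) x = heatD1 τ (b j) (F j i) x + heatD1 τ (b j) (G j i) x :=
    fun j => heatD1_add_of_top (hF j i) (hG j i) hτ (b j) x
  have h3 : ∀ j k, (∫ σ in Ioi (0 : ℝ), heatD3 (τ + σ) (b i) (b j) (b k) (F j k + G j k) x) =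
      (∫ σ in Ioi (0 : ℝ), heatD3 (τ + σ) (b i) (b j) (b k) (F j k) x) +
        ∫ σ in Ioi (0 : ℝ), heatD3 (τ + σ) (b i) (b j) (b k) (G j k) x := by
    intro j k
    rw [← integral_add (integrableOn_heatD3_const_add_of_top hE (hF j k) hτ i j k x)
      (integrableOn_heatD3_const_add_of_top hE (hG j k) hτ i j k x)]
    refine setIntegral_congr_fun measurableSet_Ioi fun σ hσ => ?_
    exact heatD3_add_of_top (hF j k) (hG j k) (by linarith [mem_Ioi.1 hσ]) _ _ _ x
  simp_rw [h1, h3, Finset.sum_add_distrib]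
  ring

omit hE in
/-- **Homogeneity of `𝒩_τ` on bounded matrix fields**. [folklore] -/
theorem oseenHeat_const_mul_of_top (hF : ∀ j k, MemLp (F j k) ∞ volume) (a : ℝ)
    {τ : ℝ} (hτ : 0 < τ) (i : Fin (Module.finrank ℝ E)) (x : E) :
    oseenHeat τ (fun j k z => a * F j k z) i x = a * oseenHeat τ F i x := by
  unfold oseenHeat
  set b := stdOrthonormalBasis ℝ E
  have h1 : ∀ j, heatD1 τ (b j) (fun z => a * F j i z) x = a * heatD1 τ (b j) (F j i) x :=
    fun j => heatD1_const_mul a (F j i) τ (b j) x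
  have h3 : ∀ j k, (∫ σ in Ioi (0 : ℝ), heatD3 (τ + σ) (b i) (b j) (b k) (fun z => a * F j k z) x) =
      a * ∫ σ in Ioi (0 : ℝ), heatD3 (τ + σ) (b i) (b j) (b k) (F j k) x := by
    intro j k
    rw [← integral_const_mul]
    refine setIntegral_congr_fun measurableSet_Ioi fun σ hσ => ?_
    exact heatD3_const_mul (hF j k) a (by linarith [mem_Ioi.1 hσ]) _ _ _ x
  simp_rw [h1, h3, ← Finset.mul_sum]
  ring

omit hE in
/-- **`𝒩_τ` kills constant tensors**: `e^{τΔ}P∇·(c ⊗ c') = 0` (every term is a derivative of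
the caloric extension of a constant). [folklore] -/
theorem oseenHeat_const (c : Fin (Module.finrank ℝ E) → Fin (Module.finrank ℝ E) → ℝ)
    {τ : ℝ} (hτ : 0 < τ) (i : Fin (Module.finrank ℝ E)) (x : E) :
    oseenHeat τ (fun j k (_ : E) => c j k) i x = 0 := by
  unfold oseenHeat
  have h1 : ∀ j, heatD1 τ (stdOrthonormalBasis ℝ E j) (fun _ : E => c j i) x = 0 :=
    fun j => heatD1_const _ hτ _ x
  have h3 : ∀ j k, (∫ σ in Ioi (0 : ℝ), heatD3 (τ + σ) (stdOrthonormalBasis ℝ E i)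
      (stdOrthonormalBasis ℝ E j) (stdOrthonormalBasis ℝ E k) (fun _ : E => c j k) x) = 0 := by
    intro j k
    have he : EqOn (fun σ : ℝ => heatD3 (τ + σ) (stdOrthonormalBasis ℝ E i)
        (stdOrthonormalBasis ℝ E j) (stdOrthonormalBasis ℝ E k) (fun _ : E => c j k) x)
        (fun _ => 0) (Ioi 0) := fun σ hσ => heatD3_const _ (by linarith [mem_Ioi.1 hσ]) _ _ _ x
    rw [setIntegral_congr_fun measurableSet_Ioi he, integral_zero]
  simp [h1, h3]

end OseenAlgebra

/-! ### The heat extension of a bounded weakly divergence-free field is divergence free -/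

section DivFree

variable {E : Type*} [NormedAddCommGroup E] [InnerProductSpace ℝ E] [FiniteDimensional ℝ E]
  [MeasurableSpace E] [BorelSpace E]

omit [FiniteDimensional ℝ E] [MeasurableSpace E] [BorelSpace E] in
/-- The Gauss–Weierstrass kernel is smooth (it is `c · exp(−‖x‖²/4t)`). [folklore] -/
theorem contDiff_heatKernel_top (t : ℝ) {n : WithTop ℕ∞} :
    ContDiff ℝ n (UnboundedOperators.heatKernel (E := E) t) := by
  have h : UnboundedOperators.heatKernel (E := E) t = fun x =>
      (4 * Real.pi * t) ^ (-(Module.finrank ℝ E : ℝ) / 2) * Real.exp (-(1 / (4 * t)) * ‖x‖ ^ 2) :=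
    funext (UnboundedOperators.heatKernel_eq t)
  rw [h]
  exact contDiff_const.mul (Real.contDiff_exp.comp (contDiff_const.mul (contDiff_norm_sq ℝ)))

/-- The scalar components of a bounded a.e. strongly measurable field are in `L^∞`. [folklore] -/
theorem memLp_top_inner_const {U : E → E} (hUm : AEStronglyMeasurable U volume) {N : ℝ}
    (hUN : ∀ y, ‖U y‖ ≤ N) (c : E) : MemLp (fun y => ⟪U y, c⟫) ∞ volume :=
  memLp_top_of_bound (hUm.inner aestronglyMeasurable_const) (N * ‖c‖)
    (Eventually.of_forall fun y => (norm_inner_le_norm _ _).trans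
      (mul_le_mul_of_nonneg_right (hUN y) (norm_nonneg _)))

/-- `heatD1 s v φ x = ∫ ∂ᵥG_s(w) φ(x − w) dw` for `φ ∈ L^∞`. [folklore] -/
theorem heatD1_eq_integral_of_top {φ : E → ℝ} (hφ : MemLp φ ∞ volume) {s : ℝ} (hs : 0 < s) (v x : E) :
    heatD1 s v φ x = ∫ w, fderiv ℝ (UnboundedOperators.heatKernel s) w v * φ (x - w) := by
  rw [heatD1_eq_convolution hφ le_top hs v, convolution_def]
  rfl

/-- **The heat extension of a bounded weakly divergence-free field is divergence free**:
`∑ⱼ ∂ⱼ e^{sΔ} Uⱼ (x) = 0` for `s > 0`, where `Uⱼ = ⟪U, eⱼ⟫` in the frame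
`e = stdOrthonormalBasis`. Proof: `∑ⱼ ∂ⱼ e^{sΔ}Uⱼ(x) = ∫ DG_s(w)[U(x − w)] dw
= −∫ D_y[G_s(x − y)](U(y)) dy = 0`, the weak divergence-free condition extended to the
Gaussian test function `y ↦ G_s(x − y)` (`IsWeaklyDivFree.integral_fderiv_apply_eq_zero`).
(Lemarié-Rieusset 2016, Cor. 6.2: `div e^{tΔ}u₀ = e^{tΔ} div u₀`.) [folklore] -/
theorem sum_heatD1_inner_eq_zero {U : E → E} (hUm : AEStronglyMeasurable U volume) {N : ℝ}
    (hUN : ∀ y, ‖U y‖ ≤ N) (hdiv : IsWeaklyDivFree U) {s : ℝ} (hs : 0 < s) (x : E) :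
    ∑ j, heatD1 s (stdOrthonormalBasis ℝ E j) (fun y => ⟪U y, stdOrthonormalBasis ℝ E j⟫) x = 0 := by
  set b := stdOrthonormalBasis ℝ E
  set G : E → ℝ := UnboundedOperators.heatKernel s with hG
  have hN0 : 0 ≤ N := (norm_nonneg _).trans (hUN 0)
  -- each summand as an integral
  have hint : ∀ j, Integrable (fun w => fderiv ℝ G w (b j) * ⟪U (x - w), b j⟫) volume := by
    intro j
    have hm : AEStronglyMeasurable (fun w => fderiv ℝ G w (b j) * ⟪U (x - w), b j⟫) volume := by
      refine ((UnboundedOperators.continuous_fderiv_heatKernel_apply s (b j)).aestronglyMeasurable).mul ?_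
      have h1 : AEStronglyMeasurable (fun w => U (x - w)) volume :=
        hUm.comp_measurePreserving (Measure.measurePreserving_sub_left volume x)
      exact h1.inner aestronglyMeasurable_const
    refine ((UnboundedOperators.integrable_fderiv_heatKernel_apply hs (b j)).norm.mul_const (N * 1)).mono' hm
      (Eventually.of_forall fun w => ?_)
    rw [norm_mul]
    refine mul_le_mul_of_nonneg_left ?_ (norm_nonneg _)
    exact (norm_inner_le_norm _ _).trans (mul_le_mul (hUN _) (le_of_eq (b.orthonormal.1 j))
      (norm_nonneg _) hN0)
  have hsum : ∑ j, heatD1 s (b j) (fun y => ⟪U y, b j⟫) x =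
      ∫ w, ∑ j, fderiv ℝ G w (b j) * ⟪U (x - w), b j⟫ := by
    rw [integral_finsetSum _ fun j _ => hint j]
    exact Finset.sum_congr rfl fun j _ => heatD1_eq_integral_of_top (memLp_top_inner_const hUm hUN (b j)) hs (b j) x
  -- the integrand is `DG(w)[U(x − w)]`
  have hptw : ∀ w, ∑ j, fderiv ℝ G w (b j) * ⟪U (x - w), b j⟫ = fderiv ℝ G w (U (x - w)) := by
    intro w
    have h := congrArg (fderiv ℝ G w) (b.sum_repr' (U (x - w)))
    rw [map_sum] at h
    rw [← h]
    refine Finset.sum_congr rfl fun j _ => ?_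
    rw [map_smul, smul_eq_mul, mul_comm, real_inner_comm]
  rw [hsum]
  simp_rw [hptw]
  -- change variables `w = x − y`
  rw [← integral_sub_left_eq_self (fun y => fderiv ℝ G y (U (x - y))) volume x]
  simp only [sub_sub_cancel]
  -- `D_y[G(x − y)] = −DG(x − y)`
  set θ : E → ℝ := fun y => G (x - y) with hθ
  have hθs : ContDiff ℝ ∞ θ := (contDiff_heatKernel_top s).comp (contDiff_const.sub contDiff_id)
  have hθd : ∀ y, fderiv ℝ θ y = -fderiv ℝ G (x - y) := by
    intro y
    have hGd : DifferentiableAt ℝ G (x - y) :=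
      ((contDiff_heatKernel_top (E := E) s (n := 1)).differentiable one_ne_zero) _
    have h := (hGd.hasFDerivAt.comp y ((hasFDerivAt_const x y).sub (hasFDerivAt_id y))).fderiv
    have e : θ = G ∘ (fun y => x - y) := rfl
    rw [e, h]
    ext v
    simp
  have key : ∫ y, fderiv ℝ θ y (U y) = 0 := by
    refine hdiv.integral_fderiv_apply_eq_zero hUm hθs ?_ ?_
    · -- integrability of `Dθ(U)`
      have hi : Integrable (fun y => fderiv ℝ G (x - y) (U y)) volume := by
        have hm : AEStronglyMeasurable (fun y => fderiv ℝ G (x - y) (U y)) volume := by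
          have h1 : Continuous fun y => fderiv ℝ G (x - y) :=
            (UnboundedOperators.continuous_fderiv_heatKernel s).comp (continuous_const.sub continuous_id)
          exact (isBoundedBilinearMap_apply.continuous).comp_aestronglyMeasurable (h1.aestronglyMeasurable.prodMk hUm)
        have h2 : Integrable (fun y => ‖fderiv ℝ G (x - y)‖ * N) volume := by
          have := ((UnboundedOperators.integrable_norm_fderiv_heatKernel (E := E) hs).comp_sub_left x).mul_const N
          exact this
        refine h2.mono' hm (Eventually.of_forall fun y => ?_)
        exact (ContinuousLinearMap.le_opNorm _ _).trans (mul_le_mul_of_nonneg_left (hUN y) (norm_nonneg _))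
      have : (fun y => fderiv ℝ θ y (U y)) = fun y => -(fderiv ℝ G (x - y) (U y)) := by
        funext y; rw [hθd]; rfl
      rw [this]
      exact hi.neg
    · -- integrability of `θ • U`
      have hm : AEStronglyMeasurable (fun y => θ y • U y) volume :=
        (hθs.continuous.aestronglyMeasurable).smul hUm
      have h2 : Integrable (fun y => ‖θ y‖ * N) volume := by
        have hGi : Integrable (fun y => G (x - y)) volume :=
          (UnboundedOperators.integrable_heatKernel_holds hs).comp_sub_left x
        exact hGi.norm.mul_const N
      refine h2.mono' hm (Eventually.of_forall fun y => ?_)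
      rw [norm_smul]
      exact mul_le_mul_of_nonneg_left (hUN y) (norm_nonneg _)
  have : (fun y => fderiv ℝ G (x - y) (U y)) = fun y => -(fderiv ℝ θ y (U y)) := by
    funext y; rw [hθd]; simp
  rw [this, integral_neg, key, neg_zero]

end DivFree

/-! ### The drift algebra of `𝒩_τ`: `𝒩_τ[(V + c) ⊗ (V + c)] = 𝒩_τ[V ⊗ V] + (c·∇) e^{τΔ} V` -/

section DriftAlgebra

variable {E : Type*} [NormedAddCommGroup E] [InnerProductSpace ℝ E] [FiniteDimensional ℝ E]
  [MeasurableSpace E] [BorelSpace E]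

/-- Additivity of `heatD1` over finite sums of bounded data. [folklore] -/
theorem heatD1_finset_sum_of_top {ι : Type*} (S : Finset ι) {g : ι → E → ℝ}
    (hg : ∀ l ∈ S, MemLp (g l) ∞ volume) {s : ℝ} (hs : 0 < s) (v x : E) :
    heatD1 s v (fun z => ∑ l ∈ S, g l z) x = ∑ l ∈ S, heatD1 s v (g l) x := by
  classical
  revert hg
  refine Finset.induction_on S (fun _ => ?_) (fun a S ha ih hg => ?_)
  · simp only [Finset.sum_empty]
    exact heatD1_const 0 hs v x
  · have hga : MemLp (g a) ∞ volume := hg a (Finset.mem_insert_self a S)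
    have hgS : ∀ l ∈ S, MemLp (g l) ∞ volume := fun l hl => hg l (Finset.mem_insert_of_mem hl)
    have hS : MemLp (fun z => ∑ l ∈ S, g l z) ∞ volume := memLp_finsetSum S hgS
    simp only [Finset.sum_insert ha]
    have e : (fun z => g a z + ∑ l ∈ S, g l z) = g a + fun z => ∑ l ∈ S, g l z := rfl
    rw [e, heatD1_add_of_top hga hS hs, ih hgS]

variable {φ : E → ℝ}

/-- Symmetry of `heatD2` in its two directions (Schwarz). [folklore] -/
theorem heatD2_comm_of_top (hφ : MemLp φ ∞ volume) {s : ℝ} (hs : 0 < s) (v w x : E) :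
    heatD2 s v w φ x = heatD2 s w v φ x := by
  unfold heatD2
  have h2 : ContDiff ℝ 2 (UnboundedOperators.heatExtension φ s) :=
    contDiff_infty.1 (UnboundedOperators.contDiff_heatExtension_holds hφ le_top hs) 2
  exact fderiv_fderiv_apply_comm h2 x v w

/-- Two `D¹` layers commute: `∂ᵥe^{aΔ}(∂_we^{cΔ}φ) = ∂_we^{aΔ}(∂ᵥe^{cΔ}φ)` (both are
`∂ᵥ∂_w e^{(a+c)Δ}φ`). [folklore] -/
theorem heatD1_heatD1_comm (hφ : MemLp φ ∞ volume) {a c : ℝ} (ha : 0 < a) (hc : 0 < c)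
    (v w x : E) : heatD1 a v (heatD1 c w φ) x = heatD1 a w (heatD1 c v φ) x := by
  have h1 := congrFun (heatD2_eq_heatD1_heatD1 hφ le_top ha hc v w) x
  have h2 := congrFun (heatD2_eq_heatD1_heatD1 hφ le_top ha hc w v) x
  rw [← h1, ← h2, heatD2_comm_of_top hφ (by positivity)]

variable {V : E → E} {N : ℝ}

/-- One `D¹` layer over the divergence sum vanishes:
`∑ₗ ∂ᵤe^{aΔ}(∂ₗe^{cΔ}Vₗ)(x) = 0` for bounded weakly divergence-free `V`. [folklore] -/
theorem sum_heatD1_heatD1_eq_zero (hVm : AEStronglyMeasurable V volume) (hVN : ∀ y, ‖V y‖ ≤ N)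
    (hdiv : IsWeaklyDivFree V) {a c : ℝ} (ha : 0 < a) (hc : 0 < c) (u x : E) :
    ∑ l, heatD1 a u (heatD1 c (stdOrthonormalBasis ℝ E l)
      (fun y => ⟪V y, stdOrthonormalBasis ℝ E l⟫)) x = 0 := by
  set b := stdOrthonormalBasis ℝ E
  have hg : ∀ l ∈ Finset.univ, MemLp (heatD1 c (b l) (fun y => ⟪V y, b l⟫)) ∞ volume :=
    fun l _ => memLp_top_heatD1' (memLp_top_inner_const hVm hVN (b l)) hc (b l)
  rw [← heatD1_finset_sum_of_top Finset.univ hg ha u x]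
  have h0 : (fun z => ∑ l, heatD1 c (b l) (fun y => ⟪V y, b l⟫) z) = fun _ => (0 : ℝ) :=
    funext fun z => sum_heatD1_inner_eq_zero hVm hVN hdiv hc z
  rw [h0, heatD1_const 0 ha]

/-- Two `D¹` layers over the divergence sum vanish:
`∑ₗ ∂ᵤe^{aΔ}∂ᵥe^{cΔ}(∂ₗe^{dΔ}Vₗ)(x) = 0`. [folklore] -/
theorem sum_heatD1_heatD1_heatD1_eq_zero (hVm : AEStronglyMeasurable V volume)
    (hVN : ∀ y, ‖V y‖ ≤ N) (hdiv : IsWeaklyDivFree V) {a c d : ℝ} (ha : 0 < a) (hc : 0 < c)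
    (hd : 0 < d) (u v x : E) :
    ∑ l, heatD1 a u (heatD1 c v (heatD1 d (stdOrthonormalBasis ℝ E l)
      (fun y => ⟪V y, stdOrthonormalBasis ℝ E l⟫))) x = 0 := by
  set b := stdOrthonormalBasis ℝ E
  have hg : ∀ l ∈ Finset.univ,
      MemLp (heatD1 c v (heatD1 d (b l) (fun y => ⟪V y, b l⟫))) ∞ volume := fun l _ =>
    memLp_top_heatD1' (memLp_top_heatD1' (memLp_top_inner_const hVm hVN (b l)) hd (b l)) hc v
  rw [← heatD1_finset_sum_of_top Finset.univ hg ha u x]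
  have h0 : (fun z => ∑ l, heatD1 c v (heatD1 d (b l) (fun y => ⟪V y, b l⟫)) z) =
      fun _ => (0 : ℝ) :=
    funext fun z => sum_heatD1_heatD1_eq_zero hVm hVN hdiv hc hd v z
  rw [h0, heatD1_const 0 ha]

/-- The same with the divergence index in the middle layer:
`∑ₗ ∂ᵤe^{aΔ}∂ₗe^{cΔ}(∂_we^{dΔ}Vₗ)(x) = 0` (commute the two inner layers). [folklore] -/
theorem sum_heatD1_heatD1_heatD1_eq_zero' (hVm : AEStronglyMeasurable V volume)
    (hVN : ∀ y, ‖V y‖ ≤ N) (hdiv : IsWeaklyDivFree V) {a c d : ℝ} (ha : 0 < a) (hc : 0 < c)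
    (hd : 0 < d) (u w x : E) :
    ∑ l, heatD1 a u (heatD1 c (stdOrthonormalBasis ℝ E l) (heatD1 d w
      (fun y => ⟪V y, stdOrthonormalBasis ℝ E l⟫))) x = 0 := by
  set b := stdOrthonormalBasis ℝ E
  have hsw : ∀ l, heatD1 c (b l) (heatD1 d w (fun y => ⟪V y, b l⟫)) =
      heatD1 c w (heatD1 d (b l) (fun y => ⟪V y, b l⟫)) := fun l =>
    funext fun z => heatD1_heatD1_comm (memLp_top_inner_const hVm hVN (b l)) hc hd (b l) w z
  simp_rw [hsw]
  exact sum_heatD1_heatD1_heatD1_eq_zero hVm hVN hdiv ha hc hd u w x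

/-- `∑ₖ ∂ᵢ∂ⱼ∂ₖ e^{sΔ} Vₖ (x) = 0` for bounded weakly divergence-free `V`. [folklore] -/
theorem sum_heatD3_last_eq_zero (hVm : AEStronglyMeasurable V volume) (hVN : ∀ y, ‖V y‖ ≤ N)
    (hdiv : IsWeaklyDivFree V) {s : ℝ} (hs : 0 < s) (u v x : E) :
    ∑ k, heatD3 s u v (stdOrthonormalBasis ℝ E k)
      (fun y => ⟪V y, stdOrthonormalBasis ℝ E k⟫) x = 0 := by
  have h3 : 0 < s / 3 := by positivity
  have e : s = s / 3 + s / 3 + s / 3 := by ring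
  rw [e]
  simp_rw [heatD3_eq_heatD1_heatD1_heatD1 (memLp_top_inner_const hVm hVN _) le_top h3 h3 h3]
  exact sum_heatD1_heatD1_heatD1_eq_zero hVm hVN hdiv h3 h3 h3 u v x

/-- `∑ⱼ ∂ᵢ∂ⱼ∂ₖ e^{sΔ} Vⱼ (x) = 0` for bounded weakly divergence-free `V`. [folklore] -/
theorem sum_heatD3_mid_eq_zero (hVm : AEStronglyMeasurable V volume) (hVN : ∀ y, ‖V y‖ ≤ N)
    (hdiv : IsWeaklyDivFree V) {s : ℝ} (hs : 0 < s) (u w x : E) :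
    ∑ j, heatD3 s u (stdOrthonormalBasis ℝ E j) w
      (fun y => ⟪V y, stdOrthonormalBasis ℝ E j⟫) x = 0 := by
  have h3 : 0 < s / 3 := by positivity
  have e : s = s / 3 + s / 3 + s / 3 := by ring
  rw [e]
  simp_rw [heatD3_eq_heatD1_heatD1_heatD1 (memLp_top_inner_const hVm hVN _) le_top h3 h3 h3]
  exact sum_heatD1_heatD1_heatD1_eq_zero' hVm hVN hdiv h3 h3 h3 u w x

/-- Products of a bounded component with a constant are bounded. [folklore] -/
theorem memLp_top_const_mul_inner (hVm : AEStronglyMeasurable V volume) (hVN : ∀ y, ‖V y‖ ≤ N)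
    (a : ℝ) (e : E) : MemLp (fun y => a * ⟪V y, e⟫) ∞ volume :=
  (memLp_top_inner_const hVm hVN e).const_mul a

variable (hE : Module.finrank ℝ E = 3)
include hE

/-- **`𝒩_τ[V ⊗ c] = 0`** for bounded weakly divergence-free `V` and a constant vector `c`
(tensor `(j, k) ↦ Vⱼ cₖ`): the first term is `cᵢ · div e^{τΔ}V = 0`, the Leray correction is
`∑ₖ cₖ ∂ᵢ∂ₖ div e^{(τ+σ)Δ}V = 0`. [folklore] -/
theorem oseenHeat_inner_mul_const_eq_zero (hVm : AEStronglyMeasurable V volume)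
    (hVN : ∀ y, ‖V y‖ ≤ N) (hdiv : IsWeaklyDivFree V) (c : E) {τ : ℝ} (hτ : 0 < τ)
    (i : Fin (Module.finrank ℝ E)) (x : E) :
    oseenHeat τ (fun j k y => ⟪V y, stdOrthonormalBasis ℝ E j⟫ * ⟪c, stdOrthonormalBasis ℝ E k⟫)
      i x = 0 := by
  set b := stdOrthonormalBasis ℝ E
  unfold oseenHeat
  -- first term
  have h1 : ∑ j, heatD1 τ (b j) (fun y => ⟪V y, b j⟫ * ⟪c, b i⟫) x = 0 := by
    have e : ∀ j, (fun y => ⟪V y, b j⟫ * ⟪c, b i⟫) = fun y => ⟪c, b i⟫ * ⟪V y, b j⟫ :=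
      fun j => funext fun y => mul_comm _ _
    simp_rw [e, heatD1_const_mul, ← Finset.mul_sum]
    rw [sum_heatD1_inner_eq_zero hVm hVN hdiv hτ x, mul_zero]
  -- Leray correction
  have h2 : ∑ j, ∑ k, (∫ σ in Ioi (0 : ℝ), heatD3 (τ + σ) (b i) (b j) (b k)
      (fun y => ⟪V y, b j⟫ * ⟪c, b k⟫) x) = 0 := by
    have e : ∀ j k, (fun y => ⟪V y, b j⟫ * ⟪c, b k⟫) = fun y => ⟪c, b k⟫ * ⟪V y, b j⟫ :=
      fun j k => funext fun y => mul_comm _ _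
    simp_rw [e]
    rw [Finset.sum_comm]
    refine Finset.sum_eq_zero fun k _ => ?_
    have hint : ∀ j, IntegrableOn (fun σ : ℝ => heatD3 (τ + σ) (b i) (b j) (b k)
        (fun y => ⟪c, b k⟫ * ⟪V y, b j⟫) x) (Ioi 0) := fun j =>
      integrableOn_heatD3_const_add_of_top hE (memLp_top_const_mul_inner hVm hVN _ _) hτ i j k x
    rw [← integral_finsetSum _ fun j _ => hint j]
    refine (setIntegral_congr_fun measurableSet_Ioi fun σ hσ => ?_).trans (integral_zero _ _)
    have hσ' : 0 < τ + σ := by linarith [mem_Ioi.1 hσ]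
    simp_rw [heatD3_const_mul (memLp_top_inner_const hVm hVN _) _ hσ', ← Finset.mul_sum]
    rw [sum_heatD3_mid_eq_zero hVm hVN hdiv hσ', mul_zero]
  rw [h1, h2, add_zero]

/-- **`𝒩_τ[c ⊗ V] = (c·∇) e^{τΔ} V`** for bounded weakly divergence-free `V` and a constant
vector `c` (tensor `(j, k) ↦ cⱼ Vₖ`): the first term is `∑ⱼ cⱼ ∂ⱼ e^{τΔ} Vᵢ = ∂_c e^{τΔ}Vᵢ`,
the Leray correction is `∑ⱼ cⱼ ∂ᵢ∂ⱼ div e^{(τ+σ)Δ}V = 0`. [folklore] -/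
theorem oseenHeat_const_mul_inner_eq (hVm : AEStronglyMeasurable V volume)
    (hVN : ∀ y, ‖V y‖ ≤ N) (hdiv : IsWeaklyDivFree V) (c : E) {τ : ℝ} (hτ : 0 < τ)
    (i : Fin (Module.finrank ℝ E)) (x : E) :
    oseenHeat τ (fun j k y => ⟪c, stdOrthonormalBasis ℝ E j⟫ * ⟪V y, stdOrthonormalBasis ℝ E k⟫)
      i x = heatD1 τ c (fun y => ⟪V y, stdOrthonormalBasis ℝ E i⟫) x := by
  set b := stdOrthonormalBasis ℝ E
  unfold oseenHeat
  have h1 : ∑ j, heatD1 τ (b j) (fun y => ⟪c, b j⟫ * ⟪V y, b i⟫) x =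
      heatD1 τ c (fun y => ⟪V y, b i⟫) x := by
    simp_rw [heatD1_const_mul]
    unfold heatD1
    have hc : ∑ j, ⟪c, b j⟫ • b j = c := by
      simpa [real_inner_comm] using b.sum_repr' c
    conv_rhs => rw [← hc]
    rw [map_sum]
    refine Finset.sum_congr rfl fun j _ => ?_
    rw [map_smul, smul_eq_mul]
  have h2 : ∑ j, ∑ k, (∫ σ in Ioi (0 : ℝ), heatD3 (τ + σ) (b i) (b j) (b k)
      (fun y => ⟪c, b j⟫ * ⟪V y, b k⟫) x) = 0 := by
    refine Finset.sum_eq_zero fun j _ => ?_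
    have hint : ∀ k, IntegrableOn (fun σ : ℝ => heatD3 (τ + σ) (b i) (b j) (b k)
        (fun y => ⟪c, b j⟫ * ⟪V y, b k⟫) x) (Ioi 0) := fun k =>
      integrableOn_heatD3_const_add_of_top hE (memLp_top_const_mul_inner hVm hVN _ _) hτ i j k x
    rw [← integral_finsetSum _ fun k _ => hint k]
    refine (setIntegral_congr_fun measurableSet_Ioi fun σ hσ => ?_).trans (integral_zero _ _)
    have hσ' : 0 < τ + σ := by linarith [mem_Ioi.1 hσ]
    simp_rw [heatD3_const_mul (memLp_top_inner_const hVm hVN _) _ hσ', ← Finset.mul_sum]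
    rw [sum_heatD3_last_eq_zero hVm hVN hdiv hσ', mul_zero]
  rw [h1, h2, add_zero]

omit hE in
/-- Products of bounded components are bounded. [folklore] -/
theorem memLp_top_inner_mul_inner (hVm : AEStronglyMeasurable V volume) (hVN : ∀ y, ‖V y‖ ≤ N)
    (e e' : E) : MemLp (fun y => ⟪V y, e⟫ * ⟪V y, e'⟫) ∞ volume := by
  have hN0 : 0 ≤ N := (norm_nonneg _).trans (hVN 0)
  refine memLp_top_of_bound ((hVm.inner aestronglyMeasurable_const).mul
    (hVm.inner aestronglyMeasurable_const)) (N * ‖e‖ * (N * ‖e'‖)) (Eventually.of_forall fun y => ?_)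
  rw [norm_mul]
  exact mul_le_mul ((norm_inner_le_norm _ _).trans (mul_le_mul_of_nonneg_right (hVN y) (norm_nonneg _)))
    ((norm_inner_le_norm _ _).trans (mul_le_mul_of_nonneg_right (hVN y) (norm_nonneg _)))
    (norm_nonneg _) (by positivity)

/-- **The drift algebra of the Oseen–heat operator.** For a bounded weakly divergence-free
field `V`, a constant vector `c` and `τ > 0`:
`𝒩_τ[(V + c) ⊗ (V + c)]ᵢ = 𝒩_τ[V ⊗ V]ᵢ + ∂_c e^{τΔ} Vᵢ` (the tensor `c ⊗ c` is constant,
`V ⊗ c` is killed by `div e^{τΔ}V = 0`, and `c ⊗ V` gives the transport term; dimension three).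
This is the operator identity behind "`U_t = ΔU − P∇·(U⊗U) − (b·∇)U`" for a drift-mild pair
`(U, b)` of KNSS 2009, Lemma 3.1. [folklore] -/
theorem oseenHeat_driftTensor_eq (hVm : AEStronglyMeasurable V volume) (hVN : ∀ y, ‖V y‖ ≤ N)
    (hdiv : IsWeaklyDivFree V) (c : E) {τ : ℝ} (hτ : 0 < τ) (i : Fin (Module.finrank ℝ E))
    (x : E) :
    oseenHeat τ (fun j k y => ⟪V y + c, stdOrthonormalBasis ℝ E j⟫ *
        ⟪V y + c, stdOrthonormalBasis ℝ E k⟫) i x =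
      oseenHeat τ (fun j k y => ⟪V y, stdOrthonormalBasis ℝ E j⟫ *
        ⟪V y, stdOrthonormalBasis ℝ E k⟫) i x +
      heatD1 τ c (fun y => ⟪V y, stdOrthonormalBasis ℝ E i⟫) x := by
  set b := stdOrthonormalBasis ℝ E
  -- the four tensors
  set T0 : Fin (Module.finrank ℝ E) → Fin (Module.finrank ℝ E) → E → ℝ :=
    fun j k y => ⟪V y, b j⟫ * ⟪V y, b k⟫
  set TA : Fin (Module.finrank ℝ E) → Fin (Module.finrank ℝ E) → E → ℝ :=
    fun j k y => ⟪V y, b j⟫ * ⟪c, b k⟫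
  set TB : Fin (Module.finrank ℝ E) → Fin (Module.finrank ℝ E) → E → ℝ :=
    fun j k y => ⟪c, b j⟫ * ⟪V y, b k⟫
  set TC : Fin (Module.finrank ℝ E) → Fin (Module.finrank ℝ E) → E → ℝ :=
    fun j k _ => ⟪c, b j⟫ * ⟪c, b k⟫
  have h0 : ∀ j k, MemLp (T0 j k) ∞ volume := fun j k => memLp_top_inner_mul_inner hVm hVN _ _
  have hA : ∀ j k, MemLp (TA j k) ∞ volume := fun j k =>
    (memLp_top_inner_const hVm hVN (b j)).mul_const _
  have hB : ∀ j k, MemLp (TB j k) ∞ volume := fun j k => memLp_top_const_mul_inner hVm hVN _ _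
  have hC : ∀ j k, MemLp (TC j k) ∞ volume := fun j k => memLp_top_const _
  have hexp : (fun j k y => ⟪V y + c, b j⟫ * ⟪V y + c, b k⟫) =
      fun j k => ((T0 j k + TA j k) + TB j k) + TC j k := by
    funext j k y
    simp only [T0, TA, TB, TC, Pi.add_apply, inner_add_left]
    ring
  rw [hexp, oseenHeat_add_of_top hE (fun j k => ((h0 j k).add (hA j k)).add (hB j k)) hC hτ,
    oseenHeat_add_of_top hE (fun j k => (h0 j k).add (hA j k)) hB hτ,
    oseenHeat_add_of_top hE h0 hA hτ]
  have eA : oseenHeat τ TA i x = 0 := oseenHeat_inner_mul_const_eq_zero hE hVm hVN hdiv c hτ i x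
  have eB : oseenHeat τ TB i x = heatD1 τ c (fun y => ⟪V y, b i⟫) x :=
    oseenHeat_const_mul_inner_eq hE hVm hVN hdiv c hτ i x
  have eC : oseenHeat τ TC i x = 0 := oseenHeat_const (fun j k => ⟪c, b j⟫ * ⟪c, b k⟫) hτ i x
  rw [eA, eB, eC]
  ring

end DriftAlgebra

/-! ### Components of the vector caloric extension -/

section Components

variable {E : Type*} [NormedAddCommGroup E] [InnerProductSpace ℝ E] [FiniteDimensional ℝ E]
  [MeasurableSpace E] [BorelSpace E]

variable {g : E → E} {C : ℝ}

/-- The convolution integrand of the caloric extension of bounded measurable vector data is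
integrable. [folklore] -/
theorem integrable_heatKernel_smul_of_norm_le (hgm : AEStronglyMeasurable g volume)
    (hC : ∀ z, ‖g z‖ ≤ C) {τ : ℝ} (hτ : 0 < τ) (x : E) :
    Integrable (fun y => UnboundedOperators.heatKernel τ y • g (x - y)) volume := by
  have hm : AEStronglyMeasurable (fun y => UnboundedOperators.heatKernel τ y • g (x - y)) volume :=
    (UnboundedOperators.continuous_heatKernel τ).aestronglyMeasurable.smul
      (hgm.comp_measurePreserving (Measure.measurePreserving_sub_left volume x))
  refine (((UnboundedOperators.integrable_heatKernel_holds hτ).norm).mul_const C).mono' hm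
    (Eventually.of_forall fun y => ?_)
  rw [norm_smul]
  exact mul_le_mul_of_nonneg_left (hC _) (norm_nonneg _)

/-- **Components of the vector caloric extension**: `⟪e^{τΔ}g (x), c⟫ = e^{τΔ}⟪g, c⟫ (x)` for
bounded measurable `g` and `τ > 0`. [folklore] -/
theorem inner_heatExtension_eq (hgm : AEStronglyMeasurable g volume) (hC : ∀ z, ‖g z‖ ≤ C)
    {τ : ℝ} (hτ : 0 < τ) (c x : E) :
    ⟪UnboundedOperators.heatExtension g τ x, c⟫ =
      UnboundedOperators.heatExtension (fun y => ⟪g y, c⟫) τ x := by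
  haveI : CompleteSpace E := FiniteDimensional.complete ℝ E
  rw [UnboundedOperators.heatExtension_apply, UnboundedOperators.heatExtension_apply,
    real_inner_comm, ← integral_inner (integrable_heatKernel_smul_of_norm_le hgm hC hτ x) c]
  refine integral_congr_ae (Eventually.of_forall fun y => ?_)
  simp only [inner_smul_right, smul_eq_mul, real_inner_comm]

/-- **Components of the derivative of the vector caloric extension**:
`heatD1 τ v ⟪g, c⟫ (x) = ⟪D(e^{τΔ}g)(x)[v], c⟫`. [folklore] -/
theorem heatD1_inner_eq (hgm : AEStronglyMeasurable g volume) (hC : ∀ z, ‖g z‖ ≤ C)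
    {τ : ℝ} (hτ : 0 < τ) (c v x : E) :
    heatD1 τ v (fun y => ⟪g y, c⟫) x =
      ⟪fderiv ℝ (UnboundedOperators.heatExtension g τ) x v, c⟫ := by
  haveI : CompleteSpace E := FiniteDimensional.complete ℝ E
  unfold heatD1
  have hfun : UnboundedOperators.heatExtension (fun y => ⟪g y, c⟫) τ =
      fun x => ⟪UnboundedOperators.heatExtension g τ x, c⟫ :=
    funext fun x => (inner_heatExtension_eq hgm hC hτ c x).symm
  rw [hfun]
  have hd : DifferentiableAt ℝ (UnboundedOperators.heatExtension g τ) x :=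
    ((UnboundedOperators.contDiff_heatExtension_holds (memLp_top_of_bound hgm C
      (Eventually.of_forall hC)) le_top hτ).differentiable (by simp)) x
  rw [fderiv_inner_apply ℝ hd (differentiableAt_const c)]
  simp [real_inner_comm]

omit [MeasurableSpace E] [BorelSpace E] in
/-- Reassembling a vector from the frame: `∑ᵢ ⟪w, eᵢ⟫ eᵢ = w`. [folklore] -/
theorem sum_inner_stdOrthonormalBasis_smul (w : E) :
    ∑ i, ⟪w, stdOrthonormalBasis ℝ E i⟫ • stdOrthonormalBasis ℝ E i = w := by
  simpa [real_inner_comm] using (stdOrthonormalBasis ℝ E).sum_repr' w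

/-- **The transport term in vector form**: `∑ᵢ heatD1 τ v ⟪g, eᵢ⟫ (x) eᵢ = D(e^{τΔ}g)(x)[v]`. [folklore] -/
theorem sum_heatD1_inner_smul_eq (hgm : AEStronglyMeasurable g volume) (hC : ∀ z, ‖g z‖ ≤ C)
    {τ : ℝ} (hτ : 0 < τ) (v x : E) :
    ∑ i, heatD1 τ v (fun y => ⟪g y, stdOrthonormalBasis ℝ E i⟫) x • stdOrthonormalBasis ℝ E i =
      fderiv ℝ (UnboundedOperators.heatExtension g τ) x v := by
  simp_rw [heatD1_inner_eq hgm hC hτ]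
  exact sum_inner_stdOrthonormalBasis_smul _

end Components

/-! ### The restarted caloric evolution of a drift-mild field and its drift algebra -/

section Restart

variable {E : Type*} [NormedAddCommGroup E] [InnerProductSpace ℝ E] [FiniteDimensional ℝ E]
  [MeasurableSpace E] [BorelSpace E]

namespace IsKNSSDriftMild

variable {T N : ℝ} {U : ℝ → E → E} {b : ℝ → E}

/-- A slice of a drift-mild field in the window is a.e. strongly measurable. [folklore] -/
theorem aestronglyMeasurable_slice (h : IsKNSSDriftMild T N U b) (t : ℝ) :
    AEStronglyMeasurable (U t) volume :=
  (h.measurable.comp (measurable_const.prodMk measurable_id)).aestronglyMeasurable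

omit [MeasurableSpace E] [BorelSpace E] in
/-- The zero-drift tensor is the pure tensor `U ⊗ U`. [folklore] -/
theorem driftTensor_zero_apply (U : ℝ → E → E) (σ : ℝ) (j k : Fin (Module.finrank ℝ E)) (y : E) :
    driftTensor U 0 σ j k y =
      ⟪U σ y, stdOrthonormalBasis ℝ E j⟫ * ⟪U σ y, stdOrthonormalBasis ℝ E k⟫ := by
  simp [driftTensor]

variable (hE : Module.finrank ℝ E = 3)
include hE

/-- **The restarted caloric evolution** of a drift-mild field: for `0 < s < σ < T` and
`σ < t`, `e^{(t−σ)Δ}U(σ) = e^{(t−s)Δ}U(s) − ∫ₛ^σ 𝒩_{t−ρ}[(U+b)⊗(U+b)](ρ) dρ` (apply `e^{(t−σ)Δ}`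
to the drift-mild identity at `(s, σ)`: the heat semigroup law and the restart of the Duhamel
integral `heatExtension_integral_sum_oseenHeat_duhamel`). [folklore] -/
theorem heatExtension_slice_eq (h : IsKNSSDriftMild T N U b) {s σ t : ℝ} (hs : 0 < s)
    (hsσ : s < σ) (hσT : σ < T) (hσt : σ < t) (z : E) :
    UnboundedOperators.heatExtension (U σ) (t - σ) z =
      UnboundedOperators.heatExtension (U s) (t - s) z -
        ∫ ρ in s..σ, ∑ i, oseenHeat (t - ρ) (driftTensor U b ρ) i z • stdOrthonormalBasis ℝ E i := by
  haveI : CompleteSpace E := FiniteDimensional.complete ℝ E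
  have hsT : s ∈ Ioo 0 T := ⟨hs, hsσ.trans hσT⟩
  have hσ0T : σ ∈ Ioo 0 T := ⟨hs.trans hsσ, hσT⟩
  have hN : 0 ≤ N := h.nonneg
  -- the drift-mild identity at `(s, σ)` as functions
  have hmild : U σ = fun w => UnboundedOperators.heatExtension (U s) (σ - s) w -
      driftDuhamel U b s σ w := funext fun w => h.mild s σ hs hsσ hσT w
  -- both pieces are continuous and bounded
  have hc1 : Continuous fun w => UnboundedOperators.heatExtension (U s) (σ - s) w :=
    (UnboundedOperators.contDiff_heatExtension_holds (h.memLp_top_slice hsT) le_top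
      (sub_pos.2 hsσ)).continuous
  have hb1 : ∀ w, ‖UnboundedOperators.heatExtension (U s) (σ - s) w‖ ≤ N := fun w =>
    UnboundedOperators.norm_heatExtension_le (fun y => h.norm_le s hsT y) (sub_pos.2 hsσ) w
  have hc2 : Continuous (driftDuhamel U b s σ) := h.continuous_driftDuhamel hE hs.le hsσ.le hσT.le
  have hb2 : ∀ w, ‖driftDuhamel U b s σ w‖ ≤ 70632 * N ^ 2 * (σ - s) ^ (1 / 2 : ℝ) := fun w =>
    h.norm_driftDuhamel_le hE hs.le hsσ.le hσT.le w
  rw [hmild, UnboundedOperators.heatExtension_sub_of_bound hc1 hc2 hb1 hb2 (sub_pos.2 hσt) z]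
  congr 1
  · -- semigroup law
    have e := congrFun (UnboundedOperators.heatExtension_add_holds (h.memLp_top_slice hsT) le_top
      (sub_pos.2 hsσ) (sub_pos.2 hσt)) z
    rw [e]
    congr 1
    ring
  · -- restart of the Duhamel integral
    have hB : ∀ ρ ∈ Ioo s σ, ∀ j k y, |driftTensor U b ρ j k y| ≤ 4 * N ^ 2 := fun ρ hρ j k y =>
      h.abs_driftTensor_le ⟨hs.trans hρ.1, hρ.2.trans hσT⟩ j k y
    have hfun : driftDuhamel U b s σ = fun y => ∫ ρ in s..σ, ∑ i,
        oseenHeat (σ - ρ) (driftTensor U b ρ) i y • stdOrthonormalBasis ℝ E i := rfl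
    rw [hfun]
    exact heatExtension_integral_sum_oseenHeat_duhamel hE h.measurable_driftTensor (by positivity)
      hsσ.le hσt hB z

/-- **Drift algebra of the Duhamel integrand of a drift-mild pair**: for a.e. `ρ` in the window
(those at which `U(ρ)` is weakly divergence free) and every `t > ρ`,
`𝒩_{t−ρ}[(U+b)⊗(U+b)](ρ)(z) = 𝒩_{t−ρ}[U⊗U](ρ)(z) + D(e^{(t−ρ)Δ}U(ρ))(z)[b(ρ)]`. [folklore] -/
theorem sum_oseenHeat_driftTensor_smul_eq (h : IsKNSSDriftMild T N U b) {ρ : ℝ} (hρ : ρ ∈ Ioo 0 T)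
    (hdiv : IsWeaklyDivFree (U ρ)) {t : ℝ} (hρt : ρ < t) (z : E) :
    ∑ i, oseenHeat (t - ρ) (driftTensor U b ρ) i z • stdOrthonormalBasis ℝ E i =
      ∑ i, oseenHeat (t - ρ) (driftTensor U 0 ρ) i z • stdOrthonormalBasis ℝ E i +
        fderiv ℝ (UnboundedOperators.heatExtension (U ρ) (t - ρ)) z (b ρ) := by
  have hVm := h.aestronglyMeasurable_slice ρ
  have hVN : ∀ y, ‖U ρ y‖ ≤ N := fun y => h.norm_le ρ hρ y
  rw [← sum_heatD1_inner_smul_eq hVm hVN (sub_pos.2 hρt) (b ρ) z, ← Finset.sum_add_distrib]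
  refine Finset.sum_congr rfl fun i _ => ?_
  rw [← add_smul]
  congr 1
  have e1 : driftTensor U b ρ = fun j k y => ⟪U ρ y + b ρ, stdOrthonormalBasis ℝ E j⟫ *
      ⟪U ρ y + b ρ, stdOrthonormalBasis ℝ E k⟫ := by
    funext j k y; rfl
  have e2 : driftTensor U 0 ρ = fun j k y => ⟪U ρ y, stdOrthonormalBasis ℝ E j⟫ *
      ⟪U ρ y, stdOrthonormalBasis ℝ E k⟫ := by
    funext j k y; exact driftTensor_zero_apply U ρ j k y
  rw [e1, e2]
  exact oseenHeat_driftTensor_eq hE hVm hVN hdiv (b ρ) (sub_pos.2 hρt) i z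

end IsKNSSDriftMild

end Restart

/-! ### Equicontinuity of the heat flow in the time parameter, for bounded data -/

section HeatEquicontinuity

variable {E : Type*} [NormedAddCommGroup E] [InnerProductSpace ℝ E] [FiniteDimensional ℝ E]
  [MeasurableSpace E] [BorelSpace E]
variable {F' : Type*} [NormedAddCommGroup F'] [NormedSpace ℝ F'] [CompleteSpace F']

/-- **Time modulus of the heat flow on Lipschitz data**: for `g` continuous, bounded and
`A`-Lipschitz and `0 < r ≤ r'`, `‖e^{r'Δ}g(z) − e^{rΔ}g(z)‖ ≤ (1 + 2·2^{n/2}) A (r' − r)^{1/2}`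
(`e^{r'Δ}g − e^{rΔ}g = e^{rΔ}(e^{(r'−r)Δ}g − g)`, maximum principle, and the Hölder modulus
`‖e^{hΔ}g − g‖ ≤ (1 + 2·2^{n/2}) A h^{1/2}`). [folklore] -/
theorem norm_heatExtension_sub_heatExtension_le_of_lipschitz {g : E → F'} (hg : Continuous g)
    {C A : ℝ} (hC : ∀ z, ‖g z‖ ≤ C) (hA : 0 ≤ A) (hlip : ∀ y z, ‖g y - g z‖ ≤ A * ‖y - z‖)
    {r r' : ℝ} (hr : 0 < r) (hrr' : r ≤ r') (z : E) :
    ‖UnboundedOperators.heatExtension g r' z - UnboundedOperators.heatExtension g r z‖ ≤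
      (1 + 2 * (2 : ℝ) ^ ((Module.finrank ℝ E : ℝ) / 2)) * A * (r' - r) ^ (1 / 2 : ℝ) := by
  rcases hrr'.eq_or_lt with h | h
  · subst h
    rw [sub_self, norm_zero, sub_self]
    positivity
  have hh : 0 < r' - r := sub_pos.2 h
  -- `e^{r'Δ}g = e^{rΔ}(e^{(r'−r)Δ}g)`
  have hmem : MemLp g ∞ volume := UnboundedOperators.memLp_top_of_continuous_of_bound hg hC
  have hsemi : UnboundedOperators.heatExtension g r' =
      UnboundedOperators.heatExtension (UnboundedOperators.heatExtension g (r' - r)) r := by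
    rw [UnboundedOperators.heatExtension_add_holds hmem le_top hh hr]
    congr 1; ring
  -- the inner difference `e^{(r'−r)Δ}g − g` is continuous and uniformly small
  set d : E → F' := fun w => UnboundedOperators.heatExtension g (r' - r) w - g w with hd
  have hdc : Continuous d :=
    (UnboundedOperators.contDiff_heatExtension_of_bound hg hC hh (m := 0)).continuous.sub hg
  have hdb : ∀ w, ‖d w‖ ≤ (1 + 2 * (2 : ℝ) ^ ((Module.finrank ℝ E : ℝ) / 2)) * A * (r' - r) ^ (1 / 2 : ℝ) := by
    intro w
    have := UnboundedOperators.norm_heatExtension_sub_self_le_of_holder hg hC hA zero_le_one le_rfl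
      (fun y z => by rw [Real.rpow_one]; exact hlip y z) hh w
    simpa [hd] using this
  have hgc2 : Continuous fun w => UnboundedOperators.heatExtension g (r' - r) w :=
    (UnboundedOperators.contDiff_heatExtension_of_bound hg hC hh (m := 0)).continuous
  have hgb2 : ∀ w, ‖UnboundedOperators.heatExtension g (r' - r) w‖ ≤ C := fun w =>
    UnboundedOperators.norm_heatExtension_le hC hh w
  have hsub : UnboundedOperators.heatExtension g r' z - UnboundedOperators.heatExtension g r z =
      UnboundedOperators.heatExtension d r z := by
    rw [hsemi, hd, UnboundedOperators.heatExtension_sub_of_bound hgc2 hg hgb2 hC hr z]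
  rw [hsub]
  exact UnboundedOperators.norm_heatExtension_le hdb hr z

/-- **Time modulus of the heat flow on bounded measurable data, away from `t = 0`**: for
`‖f‖ ≤ C` and `0 < τ₁ ≤ τ ≤ τ'`,
`‖e^{τ'Δ}f(z) − e^{τΔ}f(z)‖ ≤ (1 + 2·2^{n/2}) (2^{n/2} (τ₁/2)^{-1/2} C) (τ' − τ)^{1/2}`
(the data `e^{(τ₁/2)Δ}f` is Lipschitz with constant `2^{n/2}(τ₁/2)^{-1/2}C`). [folklore] -/
theorem norm_heatExtension_sub_heatExtension_le_of_bound {f : E → F'}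
    (hfm : AEStronglyMeasurable f volume) {C : ℝ} (hC : ∀ z, ‖f z‖ ≤ C) {τ₁ τ τ' : ℝ}
    (hτ₁ : 0 < τ₁) (h1 : τ₁ ≤ τ) (h2 : τ ≤ τ') (z : E) :
    ‖UnboundedOperators.heatExtension f τ' z - UnboundedOperators.heatExtension f τ z‖ ≤
      (1 + 2 * (2 : ℝ) ^ ((Module.finrank ℝ E : ℝ) / 2)) * ((2 : ℝ) ^ ((Module.finrank ℝ E : ℝ) / 2) * (τ₁ / 2) ^ (-(1 / 2 : ℝ)) * C) * (τ' - τ) ^ (1 / 2 : ℝ) := by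
  have hC0 : 0 ≤ C := (norm_nonneg _).trans (hC z)
  have hmem : MemLp f ∞ volume := memLp_top_of_bound hfm C (Eventually.of_forall hC)
  have h0 : 0 < τ₁ / 2 := by positivity
  set g : E → F' := UnboundedOperators.heatExtension f (τ₁ / 2) with hg
  have hgc : Continuous g := (UnboundedOperators.contDiff_heatExtension_holds hmem le_top h0).continuous
  have hgC : ∀ w, ‖g w‖ ≤ C := fun w => UnboundedOperators.norm_heatExtension_le hC h0 w
  have hgA : ∀ y w, ‖g y - g w‖ ≤ ((2 : ℝ) ^ ((Module.finrank ℝ E : ℝ) / 2) * (τ₁ / 2) ^ (-(1 / 2 : ℝ)) * C) * ‖y - w‖ := by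
    intro y w
    refine (convex_univ).norm_image_sub_le_of_norm_fderiv_le (𝕜 := ℝ) (f := g)
      (fun x _ => ((UnboundedOperators.contDiff_heatExtension_holds hmem le_top h0).differentiable
        (by simp)) x) (fun x _ => ?_) (mem_univ _) (mem_univ _)
    exact UnboundedOperators.norm_fderiv_heatExtension_le_of_bounded hfm hC h0 x
  -- `e^{τΔ}f = e^{(τ − τ₁/2)Δ}g`
  have hsemi : ∀ {r : ℝ}, τ₁ ≤ r → UnboundedOperators.heatExtension f r =
      UnboundedOperators.heatExtension g (r - τ₁ / 2) := by
    intro r hr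
    rw [hg, UnboundedOperators.heatExtension_add_holds hmem le_top h0 (by linarith)]
    congr 1; ring
  rw [hsemi h1, hsemi (h1.trans h2)]
  have := norm_heatExtension_sub_heatExtension_le_of_lipschitz hgc hgC (by positivity) hgA
    (r := τ - τ₁ / 2) (r' := τ' - τ₁ / 2) (by linarith) (by linarith) z
  refine this.trans (le_of_eq ?_)
  congr 1
  ring

/-- **Time modulus of `heatD1` on bounded data, away from `t = 0`**: for `φ ∈ L^∞` and
`0 < τ₁ ≤ τ ≤ τ'` there is the bound
`|heatD1 τ' v φ (z) − heatD1 τ v φ (z)| ≤ K(τ₁) ‖v‖ ‖φ‖_∞ (τ' − τ)^{1/2}` with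
`K(τ₁) = (1 + 2·2^{n/2}) 2^{n/2}(τ₁/8)^{-1/2} 2^{n/2}(τ₁/4)^{-1/2}`
(`heatD1 τ v φ = e^{(τ−τ₁/4)Δ}ψ`, `ψ = heatD1 (τ₁/4) v φ` bounded by `2^{n/2}(τ₁/4)^{-1/2}‖v‖‖φ‖_∞`).
[folklore] -/
theorem norm_heatD1_sub_heatD1_le_of_top {φ : E → ℝ} (hφ : MemLp φ ∞ volume) {τ₁ τ τ' : ℝ}
    (hτ₁ : 0 < τ₁) (h1 : τ₁ ≤ τ) (h2 : τ ≤ τ') (v z : E) :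
    ‖heatD1 τ' v φ z - heatD1 τ v φ z‖ ≤
      (1 + 2 * (2 : ℝ) ^ ((Module.finrank ℝ E : ℝ) / 2)) * ((2 : ℝ) ^ ((Module.finrank ℝ E : ℝ) / 2) * (τ₁ / 4 / 2) ^ (-(1 / 2 : ℝ)) *
        ((2 : ℝ) ^ ((Module.finrank ℝ E : ℝ) / 2) * (τ₁ / 4) ^ (-(1 / 2 : ℝ)) * ‖v‖ * (eLpNorm φ ∞ volume).toReal)) *
        (τ' - τ) ^ (1 / 2 : ℝ) := by
  have h0 : 0 < τ₁ / 4 := by positivity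
  set ψ : E → ℝ := heatD1 (τ₁ / 4) v φ with hψ
  have hψm : MemLp ψ ∞ volume := memLp_top_heatD1' hφ h0 v
  have hψb : ∀ w, ‖ψ w‖ ≤ (2 : ℝ) ^ ((Module.finrank ℝ E : ℝ) / 2) * (τ₁ / 4) ^ (-(1 / 2 : ℝ)) * ‖v‖ * (eLpNorm φ ∞ volume).toReal :=
    fun w => norm_heatD1_le_of_top hφ h0 v w
  have hsemi : ∀ {r : ℝ}, τ₁ ≤ r → heatD1 r v φ = UnboundedOperators.heatExtension ψ (r - τ₁ / 4) := by
    intro r hr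
    rw [hψ, heatExtension_heatD1 hφ le_top (by linarith) h0]
    congr 1; ring
  rw [hsemi h1, hsemi (h1.trans h2)]
  have := norm_heatExtension_sub_heatExtension_le_of_bound hψm.aestronglyMeasurable hψb
    (τ₁ := τ₁ / 4) (τ := τ - τ₁ / 4) (τ' := τ' - τ₁ / 4) h0 (by linarith) (by linarith) z
  refine this.trans (le_of_eq ?_)
  congr 1
  ring

end HeatEquicontinuity

/-! ### Joint continuity from equicontinuity in time -/

section Equicontinuity

variable {E : Type*} [NormedAddCommGroup E]

/-- **Joint continuity from continuity in space and equicontinuity in time**: if every slice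
`f τ`, `τ ∈ S`, is continuous and `τ ↦ f τ z` is continuous at each `τ₀ ∈ S` within `S`
uniformly in `z`, then `uncurry f` is continuous on `S × univ`. [folklore] -/
theorem continuousOn_uncurry_of_equicontinuous {G : Type*} [NormedAddCommGroup G]
    {f : ℝ → E → G} {S : Set ℝ} (hcont : ∀ τ ∈ S, Continuous (f τ))
    (hequi : ∀ τ₀ ∈ S, ∀ ε > 0, ∃ δ > 0, ∀ τ ∈ S, |τ - τ₀| < δ → ∀ z, ‖f τ z - f τ₀ z‖ ≤ ε) :
    ContinuousOn (uncurry f) (S ×ˢ univ) := by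
  rintro ⟨τ₀, z₀⟩ hp
  have hτ₀ : τ₀ ∈ S := (mem_prod.1 hp).1
  rw [Metric.continuousWithinAt_iff]
  intro ε hε
  have hc := (hcont τ₀ hτ₀).continuousAt (x := z₀)
  rw [Metric.continuousAt_iff] at hc
  obtain ⟨δ₁, hδ₁, hz⟩ := hc (ε / 2) (half_pos hε)
  obtain ⟨δ₂, hδ₂, hτ⟩ := hequi τ₀ hτ₀ (ε / 4) (by positivity)
  refine ⟨min δ₁ δ₂, lt_min hδ₁ hδ₂, ?_⟩
  rintro ⟨τ, z⟩ hq hd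
  have hτS : τ ∈ S := (mem_prod.1 hq).1
  rw [Prod.dist_eq, max_lt_iff] at hd
  obtain ⟨hdτ, hdz⟩ := hd
  have h1 : ‖f τ z - f τ₀ z‖ ≤ ε / 4 :=
    hτ τ hτS (by rw [← Real.dist_eq]; exact hdτ.trans_le (min_le_right _ _)) z
  have h2 : dist (f τ₀ z) (f τ₀ z₀) < ε / 2 := hz (hdz.trans_le (min_le_left _ _))
  calc dist (uncurry f (τ, z)) (uncurry f (τ₀, z₀))
      = ‖f τ z - f τ₀ z₀‖ := dist_eq_norm _ _
    _ ≤ ‖f τ z - f τ₀ z‖ + ‖f τ₀ z - f τ₀ z₀‖ := norm_sub_le_norm_sub_add_norm_sub _ _ _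
    _ < ε / 4 + ε / 2 := add_lt_add_of_le_of_lt h1 (by rwa [dist_eq_norm] at h2)
    _ ≤ ε := by linarith

end Equicontinuity

/-! ### Time continuity of drift-mild slices in the sup norm; continuity of the Duhamel
integrand and of the gradient of the restarted evolution -/

section TimeContinuity

variable {E : Type*} [NormedAddCommGroup E] [InnerProductSpace ℝ E] [FiniteDimensional ℝ E]
  [MeasurableSpace E] [BorelSpace E]

variable {F G : Fin (Module.finrank ℝ E) → Fin (Module.finrank ℝ E) → E → ℝ}

/-- **`𝒩_τ` is Lipschitz in the data, `L^∞ → L^∞`**: if `|F'ⱼₖ − Fⱼₖ| ≤ η` pointwise then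
`|(𝒩_τ F')ᵢ(x) − (𝒩_τ F)ᵢ(x)| ≤ 2943 τ^{-1/2} η` (linearity and the `L^∞` bound; dimension
three). [folklore] -/
theorem norm_oseenHeat_sub_oseenHeat_le_of_abs_sub_le (hE : Module.finrank ℝ E = 3)
    (hF : ∀ j k, MemLp (F j k) ∞ volume) (hG : ∀ j k, MemLp (G j k) ∞ volume) {η : ℝ}
    (hη : 0 ≤ η) (hFG : ∀ j k y, |G j k y - F j k y| ≤ η) {τ : ℝ} (hτ : 0 < τ)
    (i : Fin (Module.finrank ℝ E)) (x : E) :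
    ‖oseenHeat τ G i x - oseenHeat τ F i x‖ ≤ 2943 * τ ^ (-(1 / 2 : ℝ)) * η := by
  have hD : ∀ j k, MemLp (fun y => G j k y - F j k y) ∞ volume := fun j k => (hG j k).sub (hF j k)
  have hdec : G = fun j k => F j k + fun y => G j k y - F j k y := by
    funext j k y; simp
  have hadd := oseenHeat_add_of_top hE hF hD hτ i x
  rw [← hdec] at hadd
  rw [hadd, add_sub_cancel_left]
  refine norm_oseenHeat_le_of_top hE hD hη (fun j k => ?_) hτ i x
  rw [eLpNorm_exponent_top]
  exact eLpNormEssSup_le_of_ae_bound (Eventually.of_forall fun y => by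
    rw [Real.norm_eq_abs]; exact hFG j k y)

omit [MeasurableSpace E] [BorelSpace E] in
/-- Lipschitz dependence of the pure tensor on the field:
`|(U'⊗U')ⱼₖ(y) − (U⊗U)ⱼₖ(y)| ≤ 2N ‖U' y − U y‖` when `‖U‖, ‖U'‖ ≤ N`. [folklore] -/
theorem abs_tensor_sub_tensor_le {u u' : E} {N : ℝ} (hu : ‖u‖ ≤ N) (hu' : ‖u'‖ ≤ N)
    (j k : Fin (Module.finrank ℝ E)) :
    |⟪u', stdOrthonormalBasis ℝ E j⟫ * ⟪u', stdOrthonormalBasis ℝ E k⟫ -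
        ⟪u, stdOrthonormalBasis ℝ E j⟫ * ⟪u, stdOrthonormalBasis ℝ E k⟫| ≤ 2 * N * ‖u' - u‖ := by
  set e := stdOrthonormalBasis ℝ E
  have hN : 0 ≤ N := (norm_nonneg _).trans hu
  have e1 : ⟪u', e j⟫ * ⟪u', e k⟫ - ⟪u, e j⟫ * ⟪u, e k⟫ =
      ⟪u' - u, e j⟫ * ⟪u', e k⟫ + ⟪u, e j⟫ * ⟪u' - u, e k⟫ := by
    simp only [inner_sub_left]; ring
  rw [e1]
  have b1 := abs_inner_stdOrthonormalBasis_le (u' - u) j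
  have b2 := abs_inner_stdOrthonormalBasis_le u' k
  have b3 := abs_inner_stdOrthonormalBasis_le u j
  have b4 := abs_inner_stdOrthonormalBasis_le (u' - u) k
  calc |⟪u' - u, e j⟫ * ⟪u', e k⟫ + ⟪u, e j⟫ * ⟪u' - u, e k⟫|
      ≤ |⟪u' - u, e j⟫| * |⟪u', e k⟫| + |⟪u, e j⟫| * |⟪u' - u, e k⟫| := by
        refine (abs_add_le _ _).trans (le_of_eq ?_); rw [abs_mul, abs_mul]
    _ ≤ ‖u' - u‖ * N + N * ‖u' - u‖ :=
        add_le_add (mul_le_mul b1 (b2.trans hu') (abs_nonneg _) (norm_nonneg _))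
          (mul_le_mul (b3.trans hu) b4 (abs_nonneg _) hN)
    _ = 2 * N * ‖u' - u‖ := by ring

/-- Equicontinuity of the kernel weight: `τ ↦ τ^{-1/2}` is uniformly continuous on `[a, R]`,
`a > 0`. [folklore] -/
theorem rpow_neg_half_equicontinuous {a R : ℝ} (ha : 0 < a) :
    ∀ ε > 0, ∃ δ > 0, ∀ τ ∈ Icc a R, ∀ τ' ∈ Icc a R, |τ - τ'| < δ →
      |τ ^ (-(1 / 2 : ℝ)) - τ' ^ (-(1 / 2 : ℝ))| ≤ ε := by
  have hc : ContinuousOn (fun τ : ℝ => τ ^ (-(1 / 2 : ℝ))) (Icc a R) :=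
    fun τ hτ => (Real.continuousAt_rpow_const τ _ (Or.inl (ha.trans_le hτ.1).ne')).continuousWithinAt
  have hu := isCompact_Icc.uniformContinuousOn_of_continuous hc
  rw [Metric.uniformContinuousOn_iff_le] at hu
  intro ε hε
  obtain ⟨δ, hδ, h⟩ := hu ε hε
  exact ⟨δ, hδ, fun τ hτ τ' hτ' hd => by
    have := h τ hτ τ' hτ' (by rw [Real.dist_eq]; exact hd.le)
    rwa [Real.dist_eq] at this⟩

/-- The modulus of `𝒩_τ` in the time parameter, in either time order. [folklore] -/
theorem norm_oseenHeat_sub_oseenHeat_clock_le (hE : Module.finrank ℝ E = 3)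
    (hF : ∀ j k, MemLp (F j k) ∞ volume) {B : ℝ}
    (hB0 : 0 ≤ B) (hB : ∀ j k, eLpNorm (F j k) ∞ volume ≤ ENNReal.ofReal B) {τ τ' : ℝ}
    (hτ : 0 < τ) (hτ' : 0 < τ') (i : Fin (Module.finrank ℝ E)) (x : E) :
    ‖oseenHeat τ' F i x - oseenHeat τ F i x‖ ≤
      954000 * B * |τ ^ (-(1 / 2 : ℝ)) - τ' ^ (-(1 / 2 : ℝ))| := by
  rcases le_total τ τ' with h | h
  · refine (norm_oseenHeat_sub_le hE hF hB0 hB hτ h i x).trans ?_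
    exact mul_le_mul_of_nonneg_left (le_abs_self _) (by positivity)
  · rw [norm_sub_rev]
    refine (norm_oseenHeat_sub_le hE hF hB0 hB hτ' h i x).trans ?_
    rw [abs_sub_comm]
    exact mul_le_mul_of_nonneg_left (le_abs_self _) (by positivity)

omit [MeasurableSpace E] [BorelSpace E] in
/-- Operator norm through the frame: `‖A‖ ≤ ∑ₗ ‖A eₗ‖`. [folklore] -/
theorem opNorm_le_sum_norm_apply_frame {E' : Type*} [NormedAddCommGroup E'] [NormedSpace ℝ E']
    (A : E →L[ℝ] E') : ‖A‖ ≤ ∑ l, ‖A (stdOrthonormalBasis ℝ E l)‖ := by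
  refine ContinuousLinearMap.opNorm_le_bound _ (Finset.sum_nonneg fun _ _ => norm_nonneg _)
    fun x => ?_
  conv_lhs => rw [← sum_inner_stdOrthonormalBasis_smul x]
  rw [map_sum, Finset.sum_mul]
  refine (norm_sum_le _ _).trans (Finset.sum_le_sum fun l _ => ?_)
  rw [map_smul, norm_smul, Real.norm_eq_abs, mul_comm]
  exact mul_le_mul_of_nonneg_left (abs_inner_stdOrthonormalBasis_le x l) (norm_nonneg _)

omit [MeasurableSpace E] [BorelSpace E] in
/-- Norm through the frame components: `‖w‖ ≤ ∑ᵢ |⟪w, eᵢ⟫|`. [folklore] -/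
theorem norm_le_sum_abs_inner_frame (w : E) : ‖w‖ ≤ ∑ i, |⟪w, stdOrthonormalBasis ℝ E i⟫| := by
  conv_lhs => rw [← sum_inner_stdOrthonormalBasis_smul w]
  exact norm_sum_smul_stdOrthonormalBasis_le _

/-- The `heatD1` time modulus in either time order. [folklore] -/
theorem norm_heatD1_sub_heatD1_le_of_top' {φ : E → ℝ} (hφ : MemLp φ ∞ volume) {τ₁ τ τ' : ℝ}
    (hτ₁ : 0 < τ₁) (h1 : τ₁ ≤ τ) (h2 : τ₁ ≤ τ') (v z : E) :
    ‖heatD1 τ' v φ z - heatD1 τ v φ z‖ ≤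
      (1 + 2 * (2 : ℝ) ^ ((Module.finrank ℝ E : ℝ) / 2)) * ((2 : ℝ) ^ ((Module.finrank ℝ E : ℝ) / 2) * (τ₁ / 4 / 2) ^ (-(1 / 2 : ℝ)) *
        ((2 : ℝ) ^ ((Module.finrank ℝ E : ℝ) / 2) * (τ₁ / 4) ^ (-(1 / 2 : ℝ)) * ‖v‖ * (eLpNorm φ ∞ volume).toReal)) *
        |τ' - τ| ^ (1 / 2 : ℝ) := by
  rcases le_total τ τ' with h | h
  · rw [abs_of_nonneg (sub_nonneg.2 h)]
    exact norm_heatD1_sub_heatD1_le_of_top hφ hτ₁ h1 h v z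
  · rw [norm_sub_rev, abs_of_nonpos (sub_nonpos.2 h), neg_sub]
    exact norm_heatD1_sub_heatD1_le_of_top hφ hτ₁ h2 h v z

namespace IsKNSSDriftMild

variable {T N : ℝ} {U : ℝ → E → E} {b : ℝ → E}

variable (hE : Module.finrank ℝ E = 3)
include hE

/-- **Hölder-`1/2` time continuity of drift-mild slices in the sup norm**: for
`0 < s`, `s + τ₁ ≤ ρ ≤ ρ' < T` (`τ₁ > 0`) and every `z`,
`‖U(ρ', z) − U(ρ, z)‖ ≤ ((1 + 2·2^{n/2}) 2^{n/2} (τ₁/2)^{-1/2} N + 5741658 · 4N²) (ρ' − ρ)^{1/2}`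
(the drift-mild identity at `(s, ρ)` and `(s, ρ')`: the caloric parts differ by the time modulus of
the heat flow away from `t = 0`, the Duhamel parts by the Hölder modulus
`norm_integral_sum_oseenHeat_duhamel_sub_le`). [folklore] -/
theorem norm_slice_sub_slice_le (h : IsKNSSDriftMild T N U b) {s τ₁ ρ ρ' : ℝ} (hs : 0 < s)
    (hτ₁ : 0 < τ₁) (hρ : s + τ₁ ≤ ρ) (hρρ' : ρ ≤ ρ') (hρ'T : ρ' < T) (z : E) :
    ‖U ρ' z - U ρ z‖ ≤
      ((1 + 2 * (2 : ℝ) ^ ((Module.finrank ℝ E : ℝ) / 2)) * ((2 : ℝ) ^ ((Module.finrank ℝ E : ℝ) / 2) * (τ₁ / 2) ^ (-(1 / 2 : ℝ)) * N) + 5741658 * (4 * N ^ 2)) *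
        (ρ' - ρ) ^ (1 / 2 : ℝ) := by
  haveI : CompleteSpace E := FiniteDimensional.complete ℝ E
  have hsρ : s < ρ := by linarith
  have hsT : s ∈ Ioo 0 T := ⟨hs, hsρ.trans (hρρ'.trans_lt hρ'T)⟩
  have hN : 0 ≤ N := h.nonneg
  rw [h.mild s ρ' hs (hsρ.trans_le hρρ') hρ'T z, h.mild s ρ hs hsρ (hρρ'.trans_lt hρ'T) z]
  have e : UnboundedOperators.heatExtension (U s) (ρ' - s) z - driftDuhamel U b s ρ' z -
      (UnboundedOperators.heatExtension (U s) (ρ - s) z - driftDuhamel U b s ρ z) =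
      (UnboundedOperators.heatExtension (U s) (ρ' - s) z -
        UnboundedOperators.heatExtension (U s) (ρ - s) z) -
      (driftDuhamel U b s ρ' z - driftDuhamel U b s ρ z) := by abel
  rw [e]
  have h1 : ‖UnboundedOperators.heatExtension (U s) (ρ' - s) z -
      UnboundedOperators.heatExtension (U s) (ρ - s) z‖ ≤
      (1 + 2 * (2 : ℝ) ^ ((Module.finrank ℝ E : ℝ) / 2)) * ((2 : ℝ) ^ ((Module.finrank ℝ E : ℝ) / 2) * (τ₁ / 2) ^ (-(1 / 2 : ℝ)) * N) * (ρ' - ρ) ^ (1 / 2 : ℝ) := by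
    have := norm_heatExtension_sub_heatExtension_le_of_bound (h.aestronglyMeasurable_slice s)
      (fun y => h.norm_le s hsT y) (τ₁ := τ₁) (τ := ρ - s) (τ' := ρ' - s) hτ₁ (by linarith)
      (by linarith) z
    refine this.trans (le_of_eq ?_)
    congr 2; ring
  have h2 : ‖driftDuhamel U b s ρ' z - driftDuhamel U b s ρ z‖ ≤
      5741658 * (4 * N ^ 2) * (ρ' - ρ) ^ (1 / 2 : ℝ) := by
    have hB : ∀ σ ∈ Ioo s ρ', ∀ j k y, |driftTensor U b σ j k y| ≤ 4 * N ^ 2 := fun σ hσ j k y =>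
      h.abs_driftTensor_le ⟨hs.trans hσ.1, hσ.2.trans hρ'T⟩ j k y
    rw [driftDuhamel_apply, driftDuhamel_apply]
    exact norm_integral_sum_oseenHeat_duhamel_sub_le hE h.measurable_driftTensor (by positivity)
      hsρ.le hρρ' hB z
  calc _ ≤ _ := norm_sub_le _ _
    _ ≤ _ := add_le_add h1 h2
    _ = _ := by ring

/-- **Equicontinuity of drift-mild slices in time, uniformly in space**: at every `ρ₀` of the
window, `sup_z ‖U(ρ, z) − U(ρ₀, z)‖ → 0` as `ρ → ρ₀`. [folklore] -/
theorem slice_equicontinuous (h : IsKNSSDriftMild T N U b) {ρ₀ : ℝ} (hρ₀ : ρ₀ ∈ Ioo 0 T) :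
    ∀ ε > 0, ∃ δ > 0, ∀ ρ ∈ Ioo 0 T, |ρ - ρ₀| < δ → ∀ z, ‖U ρ z - U ρ₀ z‖ ≤ ε := by
  intro ε hε
  -- base time `s = ρ₀/4`, `τ₁ = ρ₀/4`, so that `s + τ₁ = ρ₀/2 ≤ ρ` whenever `|ρ − ρ₀| < ρ₀/2`
  set K : ℝ := (1 + 2 * (2 : ℝ) ^ ((Module.finrank ℝ E : ℝ) / 2)) * ((2 : ℝ) ^ ((Module.finrank ℝ E : ℝ) / 2) * (ρ₀ / 4 / 2) ^ (-(1 / 2 : ℝ)) * N) + 5741658 * (4 * N ^ 2)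
    with hK
  have hN : 0 ≤ N := h.nonneg
  have hρ₀0 : 0 < ρ₀ := hρ₀.1
  have hK0 : 0 ≤ K := by positivity
  refine ⟨min (ρ₀ / 2) (min 1 ((ε / (K + 1)) ^ 2)), by
    refine lt_min (by linarith [hρ₀.1]) (lt_min one_pos (by positivity)), ?_⟩
  intro ρ hρ hd z
  have hd1 : |ρ - ρ₀| < ρ₀ / 2 := hd.trans_le (min_le_left _ _)
  have hd2 : |ρ - ρ₀| < 1 := hd.trans_le ((min_le_right _ _).trans (min_le_left _ _))
  have hd3 : |ρ - ρ₀| < (ε / (K + 1)) ^ 2 :=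
    hd.trans_le ((min_le_right _ _).trans (min_le_right _ _))
  have hs : 0 < ρ₀ / 4 := by linarith [hρ₀.1]
  -- the Hölder bound in either time order
  have hmain : ‖U ρ z - U ρ₀ z‖ ≤ K * |ρ - ρ₀| ^ (1 / 2 : ℝ) := by
    rcases le_total ρ₀ ρ with hle | hle
    · have := h.norm_slice_sub_slice_le hE (s := ρ₀ / 4) (τ₁ := ρ₀ / 4) hs hs (by linarith) hle
        hρ.2 z
      rw [abs_of_nonneg (by linarith)]
      exact this
    · have := h.norm_slice_sub_slice_le hE (s := ρ₀ / 4) (τ₁ := ρ₀ / 4) hs hs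
        (by rw [abs_lt] at hd1; linarith) hle hρ₀.2 z
      rw [norm_sub_rev, abs_of_nonpos (by linarith), neg_sub]
      exact this
  refine hmain.trans ?_
  have hsq : |ρ - ρ₀| ^ (1 / 2 : ℝ) ≤ ε / (K + 1) := by
    have h0 : 0 ≤ ε / (K + 1) := by positivity
    calc |ρ - ρ₀| ^ (1 / 2 : ℝ) ≤ ((ε / (K + 1)) ^ 2) ^ (1 / 2 : ℝ) :=
          Real.rpow_le_rpow (abs_nonneg _) hd3.le (by norm_num)
      _ = ε / (K + 1) := by
          rw [← Real.sqrt_eq_rpow, Real.sqrt_sq h0]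
  calc K * |ρ - ρ₀| ^ (1 / 2 : ℝ) ≤ K * (ε / (K + 1)) := mul_le_mul_of_nonneg_left hsq hK0
    _ ≤ ε := by
        rw [mul_div_assoc', div_le_iff₀ (by positivity)]
        nlinarith

/-- **Joint continuity of the pure-tensor Duhamel integrand of a drift-mild field**:
`(ρ, z) ↦ 𝒩_{t−ρ}[U(ρ)⊗U(ρ)](z)` is continuous on `(0, min(t, T)) × E` (slices smooth;
equicontinuity in `ρ` from the sup-norm time continuity of `U` — `𝒩_τ` being Lipschitz
`L^∞ → L^∞` — and the modulus of `𝒩_τ` in `τ`). [folklore] -/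
theorem continuousOn_pureDuhamelIntegrand (h : IsKNSSDriftMild T N U b) (t : ℝ) :
    ContinuousOn (fun q : ℝ × E => ∑ i, oseenHeat (t - q.1) (driftTensor U 0 q.1) i q.2 •
      stdOrthonormalBasis ℝ E i) (Ioo 0 (min t T) ×ˢ univ) := by
  set e := stdOrthonormalBasis ℝ E
  set m := min t T with hm
  have hN : 0 ≤ N := h.nonneg
  -- data facts
  have hmem : ∀ ρ ∈ Ioo 0 T, ∀ j k, MemLp (driftTensor U 0 ρ j k) ∞ volume := by
    intro ρ hρ j k
    have e2 : driftTensor U 0 ρ j k = fun y => ⟪U ρ y, e j⟫ * ⟪U ρ y, e k⟫ :=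
      funext fun y => driftTensor_zero_apply U ρ j k y
    rw [e2]
    exact memLp_top_inner_mul_inner (h.aestronglyMeasurable_slice ρ) (fun y => h.norm_le ρ hρ y)
      (e j) (e k)
  have hbd : ∀ ρ ∈ Ioo 0 T, ∀ j k y, |driftTensor U 0 ρ j k y| ≤ 4 * N ^ 2 := fun ρ hρ j k y =>
    FluidPDE.abs_driftTensor_le (h.norm_le ρ hρ y) (by simpa using hN) j k
  have hbd' : ∀ ρ ∈ Ioo 0 T, ∀ j k, eLpNorm (driftTensor U 0 ρ j k) ∞ volume ≤
      ENNReal.ofReal (4 * N ^ 2) := fun ρ hρ j k => by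
    rw [eLpNorm_exponent_top]
    exact eLpNormEssSup_le_of_ae_bound (Eventually.of_forall fun y => by
      rw [Real.norm_eq_abs]; exact hbd ρ hρ j k y)
  refine continuousOn_uncurry_of_equicontinuous
    (f := fun ρ z => ∑ i, oseenHeat (t - ρ) (driftTensor U 0 ρ) i z • e i) ?_ ?_
  · -- slices are continuous
    intro ρ hρ
    have hρT : ρ ∈ Ioo 0 T := ⟨hρ.1, hρ.2.trans_le (min_le_right _ _)⟩
    have hτ : 0 < t - ρ := by linarith [hρ.2, min_le_left t T]
    exact continuous_finsetSum _ fun i _ =>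
      (contDiff_oseenHeat hE (hmem ρ hρT) hτ i (n := 0)).continuous.smul continuous_const
  · -- equicontinuity in time
    intro ρ₀ hρ₀ ε hε
    have hρ₀T : ρ₀ ∈ Ioo 0 T := ⟨hρ₀.1, hρ₀.2.trans_le (min_le_right _ _)⟩
    have hmt : m ≤ t := min_le_left _ _
    -- a compact range of times around `ρ₀`, with clocks `≥ a`
    set a : ℝ := (t - ρ₀) / 2 with ha
    have ha0 : 0 < a := by have := hρ₀.2; rw [ha]; linarith
    set n : ℝ := (Fintype.card (Fin (Module.finrank ℝ E)) : ℝ) with hn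
    -- the two moduli
    set K₁ : ℝ := 2943 * a ^ (-(1 / 2 : ℝ)) * (2 * N) with hK₁
    set K₂ : ℝ := 954000 * (4 * N ^ 2) with hK₂
    have hK₁0 : 0 ≤ K₁ := by positivity
    have hK₂0 : 0 ≤ K₂ := by positivity
    obtain ⟨δU, hδU, hUc⟩ := h.slice_equicontinuous hE hρ₀T (ε / (2 * (n + 1) * (K₁ + 1)))
      (by positivity)
    obtain ⟨δr, hδr, hrc⟩ := rpow_neg_half_equicontinuous (R := t) ha0
      (ε / (2 * (n + 1) * (K₂ + 1))) (by positivity)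
    refine ⟨min ((m - ρ₀) / 2) (min (ρ₀ / 2) (min δU δr)),
      lt_min (by linarith [hρ₀.2]) (lt_min (by linarith [hρ₀.1]) (lt_min hδU hδr)), ?_⟩
    intro ρ hρ hd z
    have hρT : ρ ∈ Ioo 0 T := ⟨hρ.1, hρ.2.trans_le (min_le_right _ _)⟩
    have hd0 : |ρ - ρ₀| < (m - ρ₀) / 2 := hd.trans_le (min_le_left _ _)
    have hdU : |ρ - ρ₀| < δU := hd.trans_le ((min_le_right _ _).trans ((min_le_right _ _).trans
      (min_le_left _ _)))
    have hdr : |ρ - ρ₀| < δr := hd.trans_le ((min_le_right _ _).trans ((min_le_right _ _).trans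
      (min_le_right _ _)))
    rw [abs_lt] at hd0
    have hτ : a ≤ t - ρ := by rw [ha]; linarith
    have hτ0 : 0 < t - ρ := ha0.trans_le hτ
    have hτ₀ : a ≤ t - ρ₀ := by rw [ha]; linarith [hρ₀.2]
    have hτ₀0 : 0 < t - ρ₀ := ha0.trans_le hτ₀
    -- componentwise estimate
    have hcomp : ∀ i, ‖oseenHeat (t - ρ) (driftTensor U 0 ρ) i z -
        oseenHeat (t - ρ₀) (driftTensor U 0 ρ₀) i z‖ ≤ ε / (n + 1) := by
      intro i
      -- data difference
      have hη : ∀ j k y, |driftTensor U 0 ρ j k y - driftTensor U 0 ρ₀ j k y| ≤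
          2 * N * (ε / (2 * (n + 1) * (K₁ + 1))) := by
        intro j k y
        rw [driftTensor_zero_apply, driftTensor_zero_apply]
        refine (abs_tensor_sub_tensor_le (h.norm_le ρ₀ hρ₀T y) (h.norm_le ρ hρT y) j k).trans ?_
        exact mul_le_mul_of_nonneg_left (hUc ρ hρT hdU y) (by positivity)
      have h1 : ‖oseenHeat (t - ρ) (driftTensor U 0 ρ) i z -
          oseenHeat (t - ρ) (driftTensor U 0 ρ₀) i z‖ ≤
          2943 * (t - ρ) ^ (-(1 / 2 : ℝ)) * (2 * N * (ε / (2 * (n + 1) * (K₁ + 1)))) :=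
        norm_oseenHeat_sub_oseenHeat_le_of_abs_sub_le hE (hmem ρ₀ hρ₀T) (hmem ρ hρT)
          (by positivity) hη hτ0 i z
      have h1' : ‖oseenHeat (t - ρ) (driftTensor U 0 ρ) i z -
          oseenHeat (t - ρ) (driftTensor U 0 ρ₀) i z‖ ≤ ε / (2 * (n + 1)) := by
        refine h1.trans ?_
        have hr : (t - ρ) ^ (-(1 / 2 : ℝ)) ≤ a ^ (-(1 / 2 : ℝ)) :=
          Real.rpow_le_rpow_of_nonpos ha0 hτ (by norm_num)
        calc 2943 * (t - ρ) ^ (-(1 / 2 : ℝ)) * (2 * N * (ε / (2 * (n + 1) * (K₁ + 1))))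
            ≤ 2943 * a ^ (-(1 / 2 : ℝ)) * (2 * N * (ε / (2 * (n + 1) * (K₁ + 1)))) := by
              gcongr
          _ = K₁ * (ε / (2 * (n + 1) * (K₁ + 1))) := by rw [hK₁]; ring
          _ ≤ ε / (2 * (n + 1)) := by
              rw [mul_div_assoc', div_le_div_iff₀ (by positivity) (by positivity)]
              have : 0 ≤ ε * (2 * (n + 1)) := by positivity
              nlinarith
      -- clock difference
      have h2 : ‖oseenHeat (t - ρ) (driftTensor U 0 ρ₀) i z -
          oseenHeat (t - ρ₀) (driftTensor U 0 ρ₀) i z‖ ≤ ε / (2 * (n + 1)) := by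
        have := norm_oseenHeat_sub_oseenHeat_clock_le hE (hmem ρ₀ hρ₀T) (by positivity)
          (hbd' ρ₀ hρ₀T) hτ₀0 hτ0 i z
        refine this.trans ?_
        have hr := hrc (t - ρ₀) ⟨hτ₀, by linarith [hρ₀.1]⟩ (t - ρ) ⟨hτ, by linarith [hρ.1]⟩
          (by rw [show t - ρ₀ - (t - ρ) = ρ - ρ₀ by ring]; exact hdr)
        calc 954000 * (4 * N ^ 2) * |(t - ρ₀) ^ (-(1 / 2 : ℝ)) - (t - ρ) ^ (-(1 / 2 : ℝ))|
            ≤ K₂ * (ε / (2 * (n + 1) * (K₂ + 1))) := by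
              rw [hK₂]; exact mul_le_mul_of_nonneg_left hr (by positivity)
          _ ≤ ε / (2 * (n + 1)) := by
              rw [mul_div_assoc', div_le_div_iff₀ (by positivity) (by positivity)]
              have : 0 ≤ ε * (2 * (n + 1)) := by positivity
              nlinarith
      calc _ ≤ ‖oseenHeat (t - ρ) (driftTensor U 0 ρ) i z -
              oseenHeat (t - ρ) (driftTensor U 0 ρ₀) i z‖ +
            ‖oseenHeat (t - ρ) (driftTensor U 0 ρ₀) i z -
              oseenHeat (t - ρ₀) (driftTensor U 0 ρ₀) i z‖ := norm_sub_le_norm_sub_add_norm_sub _ _ _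
        _ ≤ ε / (2 * (n + 1)) + ε / (2 * (n + 1)) := add_le_add h1' h2
        _ = ε / (n + 1) := by field_simp; ring
    -- assemble the vector
    have hvec : (∑ i, oseenHeat (t - ρ) (driftTensor U 0 ρ) i z • e i) -
        ∑ i, oseenHeat (t - ρ₀) (driftTensor U 0 ρ₀) i z • e i =
        ∑ i, (oseenHeat (t - ρ) (driftTensor U 0 ρ) i z -
          oseenHeat (t - ρ₀) (driftTensor U 0 ρ₀) i z) • e i := by
      rw [← Finset.sum_sub_distrib]
      exact Finset.sum_congr rfl fun i _ => (sub_smul _ _ _).symm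
    rw [hvec]
    refine (norm_sum_smul_stdOrthonormalBasis_le _).trans ?_
    calc ∑ i, |oseenHeat (t - ρ) (driftTensor U 0 ρ) i z - oseenHeat (t - ρ₀) (driftTensor U 0 ρ₀) i z|
        ≤ ∑ _i : Fin (Module.finrank ℝ E), ε / (n + 1) :=
          Finset.sum_le_sum fun i _ => by rw [← Real.norm_eq_abs]; exact hcomp i
      _ = n * (ε / (n + 1)) := by rw [Finset.sum_const, Finset.card_univ, hn, nsmul_eq_mul]
      _ ≤ ε := by
          rw [mul_div_assoc', div_le_iff₀ (by positivity)]
          nlinarith [show (0 : ℝ) ≤ n by positivity]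

/-- **Joint continuity of the gradient of the restarted evolution of a drift-mild field**:
`(ρ, z) ↦ D(e^{(t−ρ)Δ}U(ρ))(z)` is continuous on `(0, min(t, T)) × E` (slices smooth; in `ρ`:
the gradient bound `‖D e^{τΔ}(U(ρ) − U(ρ₀))‖ ≤ 2^{n/2}τ^{-1/2} sup‖U(ρ) − U(ρ₀)‖` and, in the
clock, the `heatD1` time modulus componentwise). [folklore] -/
theorem continuousOn_fderiv_heatExtension_slice (h : IsKNSSDriftMild T N U b) (t : ℝ) :
    ContinuousOn (fun q : ℝ × E => fderiv ℝ (UnboundedOperators.heatExtension (U q.1) (t - q.1)) q.2)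
      (Ioo 0 (min t T) ×ˢ univ) := by
  haveI : CompleteSpace E := FiniteDimensional.complete ℝ E
  set e := stdOrthonormalBasis ℝ E
  set m := min t T with hm
  have hN : 0 ≤ N := h.nonneg
  have hmemφ : ∀ ρ ∈ Ioo 0 T, ∀ i, MemLp (fun y => ⟪U ρ y, e i⟫) ∞ volume ∧
      (eLpNorm (fun y => ⟪U ρ y, e i⟫) ∞ volume).toReal ≤ N := by
    intro ρ hρ i
    have hm := memLp_top_inner_const (h.aestronglyMeasurable_slice ρ) (fun y => h.norm_le ρ hρ y) (e i)
    refine ⟨hm, ENNReal.toReal_le_of_le_ofReal hN ?_⟩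
    rw [eLpNorm_exponent_top]
    refine eLpNormEssSup_le_of_ae_bound (Eventually.of_forall fun y => ?_)
    rw [Real.norm_eq_abs]
    exact (abs_inner_stdOrthonormalBasis_le _ _).trans (h.norm_le ρ hρ y)
  refine continuousOn_uncurry_of_equicontinuous
    (f := fun ρ z => fderiv ℝ (UnboundedOperators.heatExtension (U ρ) (t - ρ)) z) ?_ ?_
  · intro ρ hρ
    have hρT : ρ ∈ Ioo 0 T := ⟨hρ.1, hρ.2.trans_le (min_le_right _ _)⟩
    have hτ : 0 < t - ρ := by linarith [hρ.2, min_le_left t T]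
    exact (UnboundedOperators.contDiff_heatExtension_holds (h.memLp_top_slice hρT) le_top
      hτ).continuous_fderiv (by simp)
  · intro ρ₀ hρ₀ ε hε
    have hρ₀T : ρ₀ ∈ Ioo 0 T := ⟨hρ₀.1, hρ₀.2.trans_le (min_le_right _ _)⟩
    have hmt : m ≤ t := min_le_left _ _
    set a : ℝ := (t - ρ₀) / 2 with ha
    have ha0 : 0 < a := by have := hρ₀.2; rw [ha]; linarith
    set n : ℝ := (Fintype.card (Fin (Module.finrank ℝ E)) : ℝ) with hn
    set K₁ : ℝ := (2 : ℝ) ^ ((Module.finrank ℝ E : ℝ) / 2) * a ^ (-(1 / 2 : ℝ)) with hK₁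
    set K₃ : ℝ := (1 + 2 * (2 : ℝ) ^ ((Module.finrank ℝ E : ℝ) / 2)) * ((2 : ℝ) ^ ((Module.finrank ℝ E : ℝ) / 2) * (a / 4 / 2) ^ (-(1 / 2 : ℝ)) *
      ((2 : ℝ) ^ ((Module.finrank ℝ E : ℝ) / 2) * (a / 4) ^ (-(1 / 2 : ℝ)) * 1 * N)) with hK₃
    have hK₁0 : 0 ≤ K₁ := by positivity
    have hK₃0 : 0 ≤ K₃ := by positivity
    obtain ⟨δU, hδU, hUc⟩ := h.slice_equicontinuous hE hρ₀T (ε / (2 * (K₁ + 1))) (by positivity)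
    -- `|ρ − ρ₀|^{1/2} ≤ ε / (2 (n²+1) (K₃+1))` once `|ρ − ρ₀| ≤ (…)²`
    set θ : ℝ := ε / (2 * (n * n + 1) * (K₃ + 1)) with hθ
    have hθ0 : 0 < θ := by positivity
    refine ⟨min ((m - ρ₀) / 2) (min (ρ₀ / 2) (min δU (θ ^ 2))),
      lt_min (by linarith [hρ₀.2]) (lt_min (by linarith [hρ₀.1]) (lt_min hδU (by positivity))), ?_⟩
    intro ρ hρ hd z
    have hρT : ρ ∈ Ioo 0 T := ⟨hρ.1, hρ.2.trans_le (min_le_right _ _)⟩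
    have hd0 : |ρ - ρ₀| < (m - ρ₀) / 2 := hd.trans_le (min_le_left _ _)
    have hdU : |ρ - ρ₀| < δU := hd.trans_le ((min_le_right _ _).trans ((min_le_right _ _).trans
      (min_le_left _ _)))
    have hdθ : |ρ - ρ₀| < θ ^ 2 := hd.trans_le ((min_le_right _ _).trans ((min_le_right _ _).trans
      (min_le_right _ _)))
    rw [abs_lt] at hd0
    have hτ : a ≤ t - ρ := by rw [ha]; linarith
    have hτ0 : 0 < t - ρ := ha0.trans_le hτ
    have hτ₀ : a ≤ t - ρ₀ := by rw [ha]; linarith [hρ₀.2]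
    have hτ₀0 : 0 < t - ρ₀ := ha0.trans_le hτ₀
    have hsq : |ρ - ρ₀| ^ (1 / 2 : ℝ) ≤ θ := by
      calc |ρ - ρ₀| ^ (1 / 2 : ℝ) ≤ (θ ^ 2) ^ (1 / 2 : ℝ) :=
            Real.rpow_le_rpow (abs_nonneg _) hdθ.le (by norm_num)
        _ = θ := by rw [← Real.sqrt_eq_rpow, Real.sqrt_sq hθ0.le]
    -- the two slices and their caloric extensions
    set f : E → E := U ρ with hf
    set f₀ : E → E := U ρ₀ with hf₀
    have hfc : Continuous f := h.continuous_slice hE hρT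
    have hf₀c : Continuous f₀ := h.continuous_slice hE hρ₀T
    have hfb : ∀ y, ‖f y‖ ≤ N := fun y => h.norm_le ρ hρT y
    have hf₀b : ∀ y, ‖f₀ y‖ ≤ N := fun y => h.norm_le ρ₀ hρ₀T y
    have hdec : UnboundedOperators.heatExtension f (t - ρ) =
        UnboundedOperators.heatExtension f₀ (t - ρ) +
          UnboundedOperators.heatExtension (fun y => f y - f₀ y) (t - ρ) := by
      funext w
      have e1 : f = fun y => f₀ y + (f y - f₀ y) := by funext y; simp
      conv_lhs => rw [e1]
      exact UnboundedOperators.heatExtension_add_of_bound hf₀c (hfc.sub hf₀c) hf₀b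
        (Ch := N + N) (fun y => (norm_sub_le _ _).trans (add_le_add (hfb y) (hf₀b y))) hτ0 w
    have hdm : AEStronglyMeasurable (fun y => f y - f₀ y) volume :=
      (hfc.sub hf₀c).aestronglyMeasurable
    have hdb : ∀ y, ‖f y - f₀ y‖ ≤ ε / (2 * (K₁ + 1)) := fun y => hUc ρ hρT hdU y
    have hd1 : DifferentiableAt ℝ (UnboundedOperators.heatExtension f₀ (t - ρ)) z :=
      ((UnboundedOperators.contDiff_heatExtension_holds (h.memLp_top_slice hρ₀T) le_top
        hτ0).differentiable (by simp)) z
    have hd2 : DifferentiableAt ℝ (UnboundedOperators.heatExtension (fun y => f y - f₀ y) (t - ρ)) z :=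
      ((UnboundedOperators.contDiff_heatExtension_holds (memLp_top_of_bound hdm _
        (Eventually.of_forall hdb)) le_top hτ0).differentiable (by simp)) z
    -- first term: data difference
    have h1 : ‖fderiv ℝ (UnboundedOperators.heatExtension f (t - ρ)) z -
        fderiv ℝ (UnboundedOperators.heatExtension f₀ (t - ρ)) z‖ ≤ ε / 2 := by
      rw [hdec, fderiv_add hd1 hd2, add_sub_cancel_left]
      refine (UnboundedOperators.norm_fderiv_heatExtension_le_of_bounded hdm hdb hτ0 z).trans ?_
      have hr : (t - ρ) ^ (-(1 / 2 : ℝ)) ≤ a ^ (-(1 / 2 : ℝ)) :=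
        Real.rpow_le_rpow_of_nonpos ha0 hτ (by norm_num)
      calc (2 : ℝ) ^ ((Module.finrank ℝ E : ℝ) / 2) * (t - ρ) ^ (-(1 / 2 : ℝ)) * (ε / (2 * (K₁ + 1)))
          ≤ (2 : ℝ) ^ ((Module.finrank ℝ E : ℝ) / 2) * a ^ (-(1 / 2 : ℝ)) * (ε / (2 * (K₁ + 1))) := by gcongr
        _ = K₁ * (ε / (2 * (K₁ + 1))) := by rw [hK₁]
        _ ≤ ε / 2 := by
            rw [mul_div_assoc', div_le_div_iff₀ (by positivity) (by positivity)]
            nlinarith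
    -- second term: clock difference, through the frame
    have h2 : ‖fderiv ℝ (UnboundedOperators.heatExtension f₀ (t - ρ)) z -
        fderiv ℝ (UnboundedOperators.heatExtension f₀ (t - ρ₀)) z‖ ≤ ε / 2 := by
      set A := fderiv ℝ (UnboundedOperators.heatExtension f₀ (t - ρ)) z -
        fderiv ℝ (UnboundedOperators.heatExtension f₀ (t - ρ₀)) z with hA
      refine (opNorm_le_sum_norm_apply_frame A).trans ?_
      have hcomp : ∀ l i, |⟪A (e l), e i⟫| ≤ K₃ * θ := by
        intro l i
        have hcl : ⟪A (e l), e i⟫ = heatD1 (t - ρ) (e l) (fun y => ⟪f₀ y, e i⟫) z -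
            heatD1 (t - ρ₀) (e l) (fun y => ⟪f₀ y, e i⟫) z := by
          rw [hA, show ∀ (B C : E →L[ℝ] E) (x : E), (B - C) x = B x - C x from fun _ _ _ => rfl,
            inner_sub_left,
            heatD1_inner_eq hf₀c.aestronglyMeasurable hf₀b hτ0,
            heatD1_inner_eq hf₀c.aestronglyMeasurable hf₀b hτ₀0]
        rw [hcl, ← Real.norm_eq_abs]
        obtain ⟨hφm, hφN⟩ := hmemφ ρ₀ hρ₀T i
        refine (norm_heatD1_sub_heatD1_le_of_top' hφm ha0 hτ₀ hτ (e l) z).trans ?_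
        have hel : ‖e l‖ ≤ 1 := norm_stdOrthonormalBasis_le_one l
        have hΔ : |t - ρ - (t - ρ₀)| ^ (1 / 2 : ℝ) ≤ θ := by
          rw [show t - ρ - (t - ρ₀) = -(ρ - ρ₀) by ring, abs_neg]; exact hsq
        have hbig : (1 + 2 * (2 : ℝ) ^ ((Module.finrank ℝ E : ℝ) / 2)) * ((2 : ℝ) ^ ((Module.finrank ℝ E : ℝ) / 2) * (a / 4 / 2) ^ (-(1 / 2 : ℝ)) *
            ((2 : ℝ) ^ ((Module.finrank ℝ E : ℝ) / 2) * (a / 4) ^ (-(1 / 2 : ℝ)) * ‖e l‖ *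
              (eLpNorm (fun y => ⟪f₀ y, e i⟫) ∞ volume).toReal)) ≤ K₃ := by
          rw [hK₃]; gcongr
        exact mul_le_mul hbig hΔ (by positivity) hK₃0
      calc ∑ l, ‖A (e l)‖ ≤ ∑ l, ∑ i, |⟪A (e l), e i⟫| :=
            Finset.sum_le_sum fun l _ => norm_le_sum_abs_inner_frame _
        _ ≤ ∑ _l : Fin (Module.finrank ℝ E), ∑ _i : Fin (Module.finrank ℝ E), K₃ * θ :=
            Finset.sum_le_sum fun l _ => Finset.sum_le_sum fun i _ => hcomp l i
        _ = n * n * (K₃ * θ) := by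
            rw [Finset.sum_const, Finset.card_univ, nsmul_eq_mul, Finset.sum_const,
              Finset.card_univ, nsmul_eq_mul, hn]; ring
        _ ≤ ε / 2 := by
            rw [hθ]
            rw [show n * n * (K₃ * (ε / (2 * (n * n + 1) * (K₃ + 1)))) =
              (n * n * K₃ * ε) / (2 * (n * n + 1) * (K₃ + 1)) by ring,
              div_le_div_iff₀ (by positivity) (by positivity)]
            have : 0 ≤ n * n := by positivity
            nlinarith
    calc ‖fderiv ℝ (UnboundedOperators.heatExtension f (t - ρ)) z -
          fderiv ℝ (UnboundedOperators.heatExtension f₀ (t - ρ₀)) z‖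
        ≤ ‖fderiv ℝ (UnboundedOperators.heatExtension f (t - ρ)) z -
            fderiv ℝ (UnboundedOperators.heatExtension f₀ (t - ρ)) z‖ +
          ‖fderiv ℝ (UnboundedOperators.heatExtension f₀ (t - ρ)) z -
            fderiv ℝ (UnboundedOperators.heatExtension f₀ (t - ρ₀)) z‖ :=
          norm_sub_le_norm_sub_add_norm_sub _ _ _
      _ ≤ ε / 2 + ε / 2 := add_le_add h1 h2
      _ = ε := add_halves ε

end IsKNSSDriftMild

end TimeContinuity

/-! ### The moving frame: differentiating `σ ↦ e^{(t−σ)Δ}U(σ)(y + B(σ))` -/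

section MovingFrame

variable {E : Type*} [NormedAddCommGroup E] [InnerProductSpace ℝ E] [FiniteDimensional ℝ E]
  [MeasurableSpace E] [BorelSpace E]

namespace IsKNSSDriftMild

variable {T N : ℝ} {U : ℝ → E → E} {b : ℝ → E}

variable (hE : Module.finrank ℝ E = 3)
include hE

/-- **The restarted evolution along the window, base point `s₀`**: for `0 < s₀ ≤ σ`, `σ < T`,
`σ < t`: `e^{(t−σ)Δ}U(σ)(w) = e^{(t−s₀)Δ}U(s₀)(w) − ∫_{s₀}^σ (𝒩_{t−ρ}[U⊗U](ρ)(w) +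
D(e^{(t−ρ)Δ}U(ρ))(w)[b(ρ)]) dρ` (`heatExtension_slice_eq` and the drift algebra
`sum_oseenHeat_driftTensor_smul_eq` at a.e. `ρ`). [folklore] -/
theorem heatExtension_slice_eq_sub_integral (h : IsKNSSDriftMild T N U b) {s₀ σ t : ℝ}
    (hs₀ : 0 < s₀) (hs₀σ : s₀ ≤ σ) (hσT : σ < T) (hσt : σ < t) (w : E) :
    UnboundedOperators.heatExtension (U σ) (t - σ) w =
      UnboundedOperators.heatExtension (U s₀) (t - s₀) w -
        ∫ ρ in s₀..σ, (∑ i, oseenHeat (t - ρ) (driftTensor U 0 ρ) i w • stdOrthonormalBasis ℝ E i +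
          fderiv ℝ (UnboundedOperators.heatExtension (U ρ) (t - ρ)) w (b ρ)) := by
  rcases hs₀σ.eq_or_lt with heq | hlt
  · subst heq; simp
  rw [h.heatExtension_slice_eq hE hs₀ hlt hσT hσt w]
  congr 1
  refine intervalIntegral.integral_congr_ae ?_
  have hae := h.ae_isWeaklyDivFree
  rw [ae_restrict_iff' measurableSet_Ioo] at hae
  filter_upwards [hae] with ρ hρ hρI
  rw [uIoc_of_le hlt.le] at hρI
  have hρT : ρ ∈ Ioo 0 T := ⟨hs₀.trans hρI.1, hρI.2.trans_lt hσT⟩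
  exact h.sum_oseenHeat_driftTensor_smul_eq hE hρT (hρ hρT) (hρI.2.trans_lt hσt) w

/-- The pure-tensor Duhamel integrand with a later observation time is interval integrable on
`[r, σ]`, `σ ≤ t`, inside the window. [folklore] -/
theorem intervalIntegrable_pureDuhamelIntegrand (h : IsKNSSDriftMild T N U b) {r σ t : ℝ}
    (hr : 0 ≤ r) (hrσ : r ≤ σ) (hσt : σ ≤ t) (hσT : σ ≤ T) (w : E) :
    IntervalIntegrable (fun ρ => ∑ i, oseenHeat (t - ρ) (driftTensor U 0 ρ) i w •
      stdOrthonormalBasis ℝ E i) volume r σ := by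
  have hN : 0 ≤ N := h.nonneg
  have hB : ∀ ρ ∈ Ioo r σ, ∀ j k y, |driftTensor U 0 ρ j k y| ≤ 4 * N ^ 2 := fun ρ hρ j k y =>
    FluidPDE.abs_driftTensor_le (h.norm_le ρ ⟨hr.trans_lt hρ.1, hρ.2.trans_le hσT⟩ y)
      (by simpa using hN) j k
  exact intervalIntegrable_sum_oseenHeat_sub_smul_of_le hE
    (FluidPDE.measurable_driftTensor h.measurable measurable_zero) (by positivity) hrσ hσt hB w

/-- The transport integrand `ρ ↦ D(e^{(t−ρ)Δ}U(ρ))(w)[b(ρ)]` is interval integrable on compact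
subintervals of `(0, min(t, T))` (continuous `CLM`-valued factor, bounded measurable `b`). [folklore] -/
theorem intervalIntegrable_transportIntegrand (h : IsKNSSDriftMild T N U b) {r σ t : ℝ}
    (hr : 0 < r) (hrσ : r ≤ σ) (hσt : σ < t) (hσT : σ < T) (w : E) :
    IntervalIntegrable (fun ρ => fderiv ℝ (UnboundedOperators.heatExtension (U ρ) (t - ρ)) w (b ρ))
      volume r σ := by
  set A : ℝ → E →L[ℝ] E := fun ρ => fderiv ℝ (UnboundedOperators.heatExtension (U ρ) (t - ρ)) w
    with hAdef
  have hsub : Icc r σ ⊆ Ioo 0 (min t T) := fun ρ hρ =>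
    ⟨hr.trans_le hρ.1, lt_min (hρ.2.trans_lt hσt) (hρ.2.trans_lt hσT)⟩
  have hA : ContinuousOn A (Icc r σ) := by
    intro ρ hρ
    have hc := (h.continuousOn_fderiv_heatExtension_slice hE t) (ρ, w)
      (mk_mem_prod (hsub hρ) (mem_univ w))
    have hι : ContinuousWithinAt (fun ρ' : ℝ => ((ρ', w) : ℝ × E)) (Icc r σ) ρ :=
      (continuous_id.prodMk continuous_const).continuousWithinAt
    exact ContinuousWithinAt.comp (f := fun ρ' : ℝ => ((ρ', w) : ℝ × E))
      (g := fun q : ℝ × E => fderiv ℝ (UnboundedOperators.heatExtension (U q.1) (t - q.1)) q.2)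
      hc hι (fun ρ' hρ' => mk_mem_prod (hsub hρ') (mem_univ w))
  -- bounded on the compact interval
  obtain ⟨M, hM⟩ := isCompact_Icc.exists_bound_of_continuousOn hA
  have hbm : AEStronglyMeasurable b volume := h.measurable_drift.aestronglyMeasurable
  have hm : AEStronglyMeasurable (fun ρ => A ρ (b ρ)) (volume.restrict (Ι r σ)) := by
    rw [uIoc_of_le hrσ]
    have hA' : AEStronglyMeasurable A (volume.restrict (Ioc r σ)) :=
      (hA.mono Ioc_subset_Icc_self).aestronglyMeasurable measurableSet_Ioc
    exact (isBoundedBilinearMap_apply.continuous).comp_aestronglyMeasurable (hA'.prodMk hbm.restrict)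
  refine (intervalIntegrable_const (c := M * N)).mono_fun' hm ?_
  rw [EventuallyLE, ae_restrict_iff' measurableSet_uIoc]
  refine Eventually.of_forall fun ρ hρ => ?_
  rw [uIoc_of_le hrσ] at hρ
  have hρ' : ρ ∈ Icc r σ := Ioc_subset_Icc_self hρ
  exact (ContinuousLinearMap.le_opNorm _ _).trans
    (mul_le_mul (hM ρ hρ') (h.norm_drift_le ρ) (norm_nonneg _) ((norm_nonneg _).trans (hM ρ hρ')))

/-- **Increments of the restarted evolution**: for `0 < s₀ ≤ σ, σ'`, both `< min(t, T)`,
`e^{(t−σ')Δ}U(σ')(w) − e^{(t−σ)Δ}U(σ)(w) = −∫_σ^{σ'} (𝒩_{t−ρ}[U⊗U](ρ)(w) +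
D(e^{(t−ρ)Δ}U(ρ))(w)[b(ρ)]) dρ`. [folklore] -/
theorem heatExtension_slice_sub_eq (h : IsKNSSDriftMild T N U b) {s₀ σ σ' t : ℝ}
    (hs₀ : 0 < s₀) (hσ : s₀ ≤ σ) (hσ' : s₀ ≤ σ') (hσT : σ < T) (hσt : σ < t) (hσ'T : σ' < T)
    (hσ't : σ' < t) (w : E) :
    UnboundedOperators.heatExtension (U σ') (t - σ') w -
        UnboundedOperators.heatExtension (U σ) (t - σ) w =
      -∫ ρ in σ..σ', (∑ i, oseenHeat (t - ρ) (driftTensor U 0 ρ) i w • stdOrthonormalBasis ℝ E i +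
          fderiv ℝ (UnboundedOperators.heatExtension (U ρ) (t - ρ)) w (b ρ)) := by
  rw [h.heatExtension_slice_eq_sub_integral hE hs₀ hσ' hσ'T hσ't w,
    h.heatExtension_slice_eq_sub_integral hE hs₀ hσ hσT hσt w]
  have hi : ∀ {τ : ℝ}, s₀ ≤ τ → τ < T → τ < t → IntervalIntegrable (fun ρ =>
      ∑ i, oseenHeat (t - ρ) (driftTensor U 0 ρ) i w • stdOrthonormalBasis ℝ E i +
        fderiv ℝ (UnboundedOperators.heatExtension (U ρ) (t - ρ)) w (b ρ)) volume s₀ τ :=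
    fun hτ hτT hτt => (h.intervalIntegrable_pureDuhamelIntegrand hE hs₀.le hτ hτt.le hτT.le w).add
      (h.intervalIntegrable_transportIntegrand hE hs₀ hτ hτt hτT w)
  rw [← intervalIntegral.integral_interval_sub_left (hi hσ' hσ'T hσ't) (hi hσ hσT hσt),
    sub_sub_sub_cancel_left, ← neg_sub]

/-- **The derivative along the moving frame.** Let `0 < s₀ < σ < t < T`, `y ∈ E`, `B = ∫ b` and
`Ψ(ρ) = e^{(t−ρ)Δ}U(ρ)(y + B(ρ))`. Then `Ψ` is differentiable at `σ` with
`Ψ'(σ) = −𝒩_{t−σ}[U⊗U](σ)(y + B(σ))`: the transport terms `−D(·)[b]` of the increments of the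
restarted evolution cancel against the displacement `B(σ') − B(σ) = ∫_σ^{σ'} b` of the frame, by
joint continuity of `D(e^{(t−ρ)Δ}U(ρ))` and of `𝒩_{t−ρ}[U⊗U](ρ)` — no differentiability of `B`
is needed. [folklore] -/
theorem hasDerivAt_movingFrame (h : IsKNSSDriftMild T N U b) {s₀ σ t : ℝ} (hs₀ : 0 < s₀)
    (hs₀σ : s₀ < σ) (hσt : σ < t) (htT : t < T) (y : E) :
    HasDerivAt (fun ρ => UnboundedOperators.heatExtension (U ρ) (t - ρ) (y + driftPath b ρ))
      (-(∑ i, oseenHeat (t - σ) (driftTensor U 0 σ) i (y + driftPath b σ) •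
        stdOrthonormalBasis ℝ E i)) σ := by
  haveI : CompleteSpace E := FiniteDimensional.complete ℝ E
  set e := stdOrthonormalBasis ℝ E
  set B : ℝ → E := driftPath b with hB
  set Φ : ℝ → E → E := fun ρ w => UnboundedOperators.heatExtension (U ρ) (t - ρ) w with hΦ
  set G : ℝ → E → E := fun ρ w => ∑ i, oseenHeat (t - ρ) (driftTensor U 0 ρ) i w • e i with hG
  have hN : 0 ≤ N := h.nonneg
  have hbm : AEStronglyMeasurable b volume := h.measurable_drift.aestronglyMeasurable
  have hbN := h.norm_drift_le
  have hσT : σ < T := hσt.trans htT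
  have hσm : σ ∈ Ioo 0 (min t T) := ⟨hs₀.trans hs₀σ, lt_min hσt hσT⟩
  -- continuity inputs at `(σ, y + B σ)`
  have hGc : ContinuousWithinAt (uncurry G) (Ioo 0 (min t T) ×ˢ univ) (σ, y + B σ) :=
    h.continuousOn_pureDuhamelIntegrand hE t (σ, y + B σ) (mk_mem_prod hσm (mem_univ _))
  have hDc : ContinuousWithinAt (fun q : ℝ × E => fderiv ℝ (Φ q.1) q.2) (Ioo 0 (min t T) ×ˢ univ)
      (σ, y + B σ) :=
    h.continuousOn_fderiv_heatExtension_slice hE t (σ, y + B σ) (mk_mem_prod hσm (mem_univ _))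
  -- differentiability of the slice `Φ σ` at `y + B σ`
  have hΦd : HasFDerivAt (Φ σ) (fderiv ℝ (Φ σ) (y + B σ)) (y + B σ) :=
    (((UnboundedOperators.contDiff_heatExtension_holds (h.memLp_top_slice ⟨hs₀.trans hs₀σ, hσT⟩)
      le_top (sub_pos.2 hσt)).differentiable (by simp)) _).hasFDerivAt
  rw [hasDerivAt_iff_isLittleO, Asymptotics.isLittleO_iff]
  intro c hc
  -- the three `c/3`-moduli
  rw [Metric.continuousWithinAt_iff] at hGc hDc
  obtain ⟨δ₁, hδ₁, hG₁⟩ := hGc (c / 3) (by positivity)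
  obtain ⟨δ₂, hδ₂, hD₂⟩ := hDc (c / (3 * (N + 1))) (by positivity)
  have hR := hΦd.isLittleO
  rw [Asymptotics.isLittleO_iff] at hR
  have hR' := hR (c := c / (3 * (N + 1))) (by positivity)
  rw [Metric.eventually_nhds_iff] at hR'
  obtain ⟨δ₃, hδ₃, hR₃⟩ := hR'
  -- the neighbourhood of `σ`
  set δ₀ : ℝ := min (σ - s₀) (t - σ) with hδ₀
  have hδ₀0 : 0 < δ₀ := lt_min (sub_pos.2 hs₀σ) (sub_pos.2 hσt)
  set δ : ℝ := min (δ₀ / 2) (min (min δ₁ δ₂ / (N + 2)) (δ₃ / (N + 1))) with hδ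
  have hδ0 : 0 < δ := by positivity
  rw [Metric.eventually_nhds_iff]
  refine ⟨δ, hδ0, fun σ' hσ' => ?_⟩
  rw [Real.dist_eq] at hσ'
  have hd0 : |σ' - σ| < δ₀ / 2 := hσ'.trans_le (min_le_left _ _)
  have hd12 : |σ' - σ| < min δ₁ δ₂ / (N + 2) :=
    hσ'.trans_le ((min_le_right _ _).trans (min_le_left _ _))
  have hd3 : |σ' - σ| < δ₃ / (N + 1) := hσ'.trans_le ((min_le_right _ _).trans (min_le_right _ _))
  rw [abs_lt] at hd0
  have hσ's : s₀ < σ' := by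
    have := min_le_left (σ - s₀) (t - σ); rw [← hδ₀] at this; linarith
  have hσ't : σ' < t := by
    have := min_le_right (σ - s₀) (t - σ); rw [← hδ₀] at this; linarith
  have hσ'T : σ' < T := hσ't.trans htT
  -- the frame displacement
  have hBsub : B σ' - B σ = ∫ ρ in σ..σ', b ρ := driftPath_sub hbm hbN σ σ'
  have hBle : ‖B σ' - B σ‖ ≤ N * |σ' - σ| := norm_driftPath_sub_le hbm hbN σ σ'
  have hN2 : N * |σ' - σ| ≤ (N + 2) * |σ' - σ| := by nlinarith [abs_nonneg (σ' - σ)]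
  have hz1 : ‖B σ' - B σ‖ < δ₁ := by
    have : (N + 2) * |σ' - σ| < min δ₁ δ₂ := by
      rwa [lt_div_iff₀ (by positivity), mul_comm] at hd12
    exact hBle.trans_lt (hN2.trans_lt (this.trans_le (min_le_left _ _)))
  have hz2 : ‖B σ' - B σ‖ < δ₂ := by
    have : (N + 2) * |σ' - σ| < min δ₁ δ₂ := by
      rwa [lt_div_iff₀ (by positivity), mul_comm] at hd12
    exact hBle.trans_lt (hN2.trans_lt (this.trans_le (min_le_right _ _)))
  have hz3 : ‖B σ' - B σ‖ < δ₃ := by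
    have : (N + 1) * |σ' - σ| < δ₃ := by rwa [lt_div_iff₀ (by positivity), mul_comm] at hd3
    exact hBle.trans_lt (lt_of_le_of_lt (by nlinarith [abs_nonneg (σ' - σ)]) this)
  have hτ1 : |σ' - σ| < δ₁ := by
    have : (N + 2) * |σ' - σ| < min δ₁ δ₂ := by
      rwa [lt_div_iff₀ (by positivity), mul_comm] at hd12
    have h1 : |σ' - σ| ≤ (N + 2) * |σ' - σ| := by nlinarith [abs_nonneg (σ' - σ)]
    exact h1.trans_lt (this.trans_le (min_le_left _ _))
  have hτ2 : |σ' - σ| < δ₂ := by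
    have : (N + 2) * |σ' - σ| < min δ₁ δ₂ := by
      rwa [lt_div_iff₀ (by positivity), mul_comm] at hd12
    have h1 : |σ' - σ| ≤ (N + 2) * |σ' - σ| := by nlinarith [abs_nonneg (σ' - σ)]
    exact h1.trans_lt (this.trans_le (min_le_right _ _))
  -- abbreviations
  set z₀ : E := y + B σ with hz₀
  set z' : E := y + B σ' with hz'
  have hzz : z' - z₀ = B σ' - B σ := by rw [hz', hz₀]; abel
  -- decomposition of the increment
  have hinc : Φ σ' z' - Φ σ z₀ = -(∫ ρ in σ..σ', (G ρ z' + fderiv ℝ (Φ ρ) z' (b ρ))) +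
      (Φ σ z' - Φ σ z₀) := by
    rw [← h.heatExtension_slice_sub_eq hE hs₀ hs₀σ.le hσ's.le hσT hσt hσ'T hσ't z']
    abel
  -- Taylor remainder of the slice
  have hrem : ‖Φ σ z' - Φ σ z₀ - fderiv ℝ (Φ σ) z₀ (z' - z₀)‖ ≤ c / (3 * (N + 1)) * ‖z' - z₀‖ := by
    have := hR₃ (y := z') (by rw [dist_eq_norm, hzz]; exact hz3)
    simpa using this
  -- the linear term is an integral of `D(Φ σ)(z₀)[b ρ]`
  have hbi : IntervalIntegrable b volume σ σ' := intervalIntegrable_of_norm_le hbm hbN σ σ'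
  have hlin : fderiv ℝ (Φ σ) z₀ (z' - z₀) = ∫ ρ in σ..σ', fderiv ℝ (Φ σ) z₀ (b ρ) := by
    rw [hzz, hBsub, (fderiv ℝ (Φ σ) z₀).intervalIntegral_comp_comm hbi]
  -- integrability of the pieces on `[σ, σ']`
  have hIG' : IntervalIntegrable (fun ρ => G ρ z') volume σ σ' := by
    rcases le_total σ σ' with hle | hle
    · exact h.intervalIntegrable_pureDuhamelIntegrand hE (hs₀.trans hs₀σ).le hle hσ't.le hσ'T.le z'
    · exact (h.intervalIntegrable_pureDuhamelIntegrand hE (hs₀.trans hσ's).le hle hσt.le hσT.le z').symm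
  have hID' : IntervalIntegrable (fun ρ => fderiv ℝ (Φ ρ) z' (b ρ)) volume σ σ' := by
    rcases le_total σ σ' with hle | hle
    · exact h.intervalIntegrable_transportIntegrand hE (hs₀.trans hs₀σ) hle hσ't hσ'T z'
    · exact (h.intervalIntegrable_transportIntegrand hE (hs₀.trans hσ's) hle hσt hσT z').symm
  have hID₀ : IntervalIntegrable (fun ρ => fderiv ℝ (Φ σ) z₀ (b ρ)) volume σ σ' :=
    intervalIntegrable_of_norm_le ((fderiv ℝ (Φ σ) z₀).continuous.comp_aestronglyMeasurable hbm)
      (fun ρ => (ContinuousLinearMap.le_opNorm (fderiv ℝ (Φ σ) z₀) (b ρ)).trans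
        (mul_le_mul_of_nonneg_left (hbN ρ) (norm_nonneg _))) σ σ'
  -- rewrite the quantity to estimate as a sum of three small terms
  have hkey : Φ σ' z' - Φ σ z₀ - (σ' - σ) • (-G σ z₀) =
      -(∫ ρ in σ..σ', (G ρ z' - G σ z₀)) - (∫ ρ in σ..σ', (fderiv ℝ (Φ ρ) z' - fderiv ℝ (Φ σ) z₀) (b ρ)) +
        (Φ σ z' - Φ σ z₀ - fderiv ℝ (Φ σ) z₀ (z' - z₀)) := by
    rw [hinc, hlin, intervalIntegral.integral_add hIG' hID',
      intervalIntegral.integral_sub hIG' intervalIntegrable_const,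
      intervalIntegral.integral_const]
    have e3 : (∫ ρ in σ..σ', (fderiv ℝ (Φ ρ) z' - fderiv ℝ (Φ σ) z₀) (b ρ)) =
        (∫ ρ in σ..σ', fderiv ℝ (Φ ρ) z' (b ρ)) - ∫ ρ in σ..σ', fderiv ℝ (Φ σ) z₀ (b ρ) := by
      rw [← intervalIntegral.integral_sub hID' hID₀]; rfl
    rw [e3, smul_neg]
    abel
  rw [hkey]
  -- bounds
  have hmem : ∀ ρ ∈ Ι σ σ', ρ ∈ Ioo 0 (min t T) ∧ |ρ - σ| < min δ₁ δ₂ := by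
    intro ρ hρ
    have hρb : |ρ - σ| ≤ |σ' - σ| := by
      rcases le_total σ σ' with hle | hle
      · rw [uIoc_of_le hle] at hρ
        rw [abs_of_nonneg (by linarith [hρ.1]), abs_of_nonneg (by linarith)]
        linarith [hρ.2]
      · rw [uIoc_of_ge hle] at hρ
        rw [abs_of_nonpos (by linarith [hρ.2]), abs_of_nonpos (by linarith)]
        linarith [hρ.1]
    have hρδ₀ : |ρ - σ| < δ₀ / 2 := hρb.trans_lt (abs_lt.2 hd0)
    rw [abs_lt] at hρδ₀
    have h1 : δ₀ ≤ σ - s₀ := min_le_left _ _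
    have h2 : δ₀ ≤ t - σ := min_le_right _ _
    refine ⟨⟨by linarith, lt_min (by linarith) (by linarith)⟩,
      lt_min (hρb.trans_lt hτ1) (hρb.trans_lt hτ2)⟩
  have b1 : ‖∫ ρ in σ..σ', (G ρ z' - G σ z₀)‖ ≤ c / 3 * |σ' - σ| := by
    refine intervalIntegral.norm_integral_le_of_norm_le_const fun ρ hρ => ?_
    obtain ⟨hρm, hρd⟩ := hmem ρ hρ
    have := hG₁ (mk_mem_prod hρm (mem_univ z')) (by
      rw [Prod.dist_eq, max_lt_iff, Real.dist_eq, dist_eq_norm, hzz]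
      exact ⟨hρd.trans_le (min_le_left _ _), hz1⟩)
    rw [dist_eq_norm] at this
    exact this.le
  have b2 : ‖∫ ρ in σ..σ', (fderiv ℝ (Φ ρ) z' - fderiv ℝ (Φ σ) z₀) (b ρ)‖ ≤ c / 3 * |σ' - σ| := by
    refine intervalIntegral.norm_integral_le_of_norm_le_const fun ρ hρ => ?_
    obtain ⟨hρm, hρd⟩ := hmem ρ hρ
    have hD := hD₂ (mk_mem_prod hρm (mem_univ z')) (by
      rw [Prod.dist_eq, max_lt_iff, Real.dist_eq, dist_eq_norm, hzz]
      exact ⟨hρd.trans_le (min_le_right _ _), hz2⟩)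
    rw [dist_eq_norm] at hD
    calc ‖(fderiv ℝ (Φ ρ) z' - fderiv ℝ (Φ σ) z₀) (b ρ)‖
        ≤ ‖fderiv ℝ (Φ ρ) z' - fderiv ℝ (Φ σ) z₀‖ * ‖b ρ‖ := ContinuousLinearMap.le_opNorm _ _
      _ ≤ c / (3 * (N + 1)) * N := mul_le_mul hD.le (hbN ρ) (norm_nonneg _) (by positivity)
      _ = c * (N / (3 * (N + 1))) := by ring
      _ ≤ c * (1 / 3) := by
          refine mul_le_mul_of_nonneg_left ?_ hc.le
          rw [div_le_div_iff₀ (by positivity) (by norm_num)]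
          linarith
      _ = c / 3 := by ring
  have b3 : ‖Φ σ z' - Φ σ z₀ - fderiv ℝ (Φ σ) z₀ (z' - z₀)‖ ≤ c / 3 * |σ' - σ| := by
    refine hrem.trans ?_
    rw [hzz]
    calc c / (3 * (N + 1)) * ‖B σ' - B σ‖ ≤ c / (3 * (N + 1)) * (N * |σ' - σ|) :=
          mul_le_mul_of_nonneg_left hBle (by positivity)
      _ = (c * |σ' - σ|) * (N / (3 * (N + 1))) := by ring
      _ ≤ (c * |σ' - σ|) * (1 / 3) := by
          refine mul_le_mul_of_nonneg_left ?_ (by positivity)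
          rw [div_le_div_iff₀ (by positivity) (by norm_num)]
          linarith
      _ = c / 3 * |σ' - σ| := by ring
  calc ‖-(∫ ρ in σ..σ', (G ρ z' - G σ z₀)) -
          (∫ ρ in σ..σ', (fderiv ℝ (Φ ρ) z' - fderiv ℝ (Φ σ) z₀) (b ρ)) +
        (Φ σ z' - Φ σ z₀ - fderiv ℝ (Φ σ) z₀ (z' - z₀))‖
      ≤ ‖∫ ρ in σ..σ', (G ρ z' - G σ z₀)‖ +
          ‖∫ ρ in σ..σ', (fderiv ℝ (Φ ρ) z' - fderiv ℝ (Φ σ) z₀) (b ρ)‖ +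
        ‖Φ σ z' - Φ σ z₀ - fderiv ℝ (Φ σ) z₀ (z' - z₀)‖ := by
        refine (norm_add_le _ _).trans (add_le_add ((norm_sub_le _ _).trans (by rw [norm_neg])) le_rfl)
    _ ≤ c / 3 * |σ' - σ| + c / 3 * |σ' - σ| + c / 3 * |σ' - σ| := add_le_add (add_le_add b1 b2) b3
    _ = c * ‖σ' - σ‖ := by rw [Real.norm_eq_abs]; ring

/-- **The zero-drift identity in the moving frame.** For `0 < s < t < T` and `y ∈ E`,
`U(t, y + B(t)) = e^{(t−s)Δ}U(s)(y + B(s)) − ∫ₛᵗ 𝒩_{t−σ}[U⊗U](σ)(y + B(σ)) dσ`: integrate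
`hasDerivAt_movingFrame` over `[s, t']` and let `t' ↑ t`, using
`e^{(t−t')Δ}U(t')(w) = U(t, w) + driftDuhamel U b t' t w` (the drift-mild identity at `(t', t)`),
`‖driftDuhamel U b t' t‖ ≤ 70632 N² (t − t')^{1/2}`, continuity of `U(t, ·)` and of `B`, and the
integrable weight `(t − σ)^{-1/2}` of the Duhamel integrand. [folklore] -/
theorem apply_add_driftPath_eq (h : IsKNSSDriftMild T N U b) {s t : ℝ} (hs : 0 < s)
    (hst : s < t) (htT : t < T) (y : E) :
    U t (y + driftPath b t) =
      UnboundedOperators.heatExtension (U s) (t - s) (y + driftPath b s) -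
        ∫ σ in s..t, ∑ i, oseenHeat (t - σ) (driftTensor U 0 σ) i (y + driftPath b σ) •
          stdOrthonormalBasis ℝ E i := by
  haveI : CompleteSpace E := FiniteDimensional.complete ℝ E
  set e := stdOrthonormalBasis ℝ E
  set B : ℝ → E := driftPath b with hB
  set Ψ : ℝ → E := fun ρ => UnboundedOperators.heatExtension (U ρ) (t - ρ) (y + B ρ) with hΨ
  set g : ℝ → E := fun σ => ∑ i, oseenHeat (t - σ) (driftTensor U 0 σ) i (y + B σ) • e i with hg
  have hN : 0 ≤ N := h.nonneg
  have hbm : AEStronglyMeasurable b volume := h.measurable_drift.aestronglyMeasurable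
  have hbN := h.norm_drift_le
  have hBc : Continuous B := continuous_driftPath hbm hbN
  -- `g` is continuous on `[s, t)` and obeys the weight bound on `(s, t)`
  have hpath : Continuous fun σ : ℝ => ((σ, y + B σ) : ℝ × E) :=
    continuous_id.prodMk (continuous_const.add hBc)
  have hgc : ContinuousOn g (Ico s t) := by
    intro σ hσ
    have hσm : σ ∈ Ioo 0 (min t T) := ⟨hs.trans_le hσ.1, lt_min hσ.2 (hσ.2.trans htT)⟩
    have hc := h.continuousOn_pureDuhamelIntegrand hE t (σ, y + B σ) (mk_mem_prod hσm (mem_univ _))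
    exact ContinuousWithinAt.comp (f := fun σ : ℝ => ((σ, y + B σ) : ℝ × E))
      (g := fun q : ℝ × E => ∑ i, oseenHeat (t - q.1) (driftTensor U 0 q.1) i q.2 • e i)
      hc hpath.continuousWithinAt fun σ' hσ' =>
        mk_mem_prod ⟨hs.trans_le hσ'.1, lt_min hσ'.2 (hσ'.2.trans htT)⟩ (mem_univ _)
  have hgb : ∀ σ ∈ Ioo s t, ‖g σ‖ ≤ 8829 * (t - σ) ^ (-(1 / 2 : ℝ)) * (4 * N ^ 2) := by
    intro σ hσ
    have hB4 : ∀ j k w, |driftTensor U 0 σ j k w| ≤ 4 * N ^ 2 := fun j k w =>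
      FluidPDE.abs_driftTensor_le (h.norm_le σ ⟨hs.trans hσ.1, hσ.2.trans htT⟩ w)
        (by simpa using hN) j k
    exact norm_sum_oseenHeat_duhamelIntegrand_smul_le hE
      (FluidPDE.measurable_driftTensor h.measurable measurable_zero) (by positivity) hσ.2 hB4 _
  have hgi : IntervalIntegrable g volume s t := by
    refine ((intervalIntegrable_rpow_neg_half_sub s t t).const_mul 8829 |>.mul_const
      (4 * N ^ 2)).mono_fun' ?_ ?_
    · rw [uIoc_of_le hst.le]
      have : AEStronglyMeasurable g (volume.restrict (Ioo s t)) :=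
        (hgc.mono Ioo_subset_Ico_self).aestronglyMeasurable measurableSet_Ioo
      rw [← restrict_Ioo_eq_restrict_Ioc]
      exact this
    · rw [EventuallyLE, ae_restrict_iff' measurableSet_uIoc, uIoc_of_le hst.le]
      refine (ae_mem_Ioc_of_forall_Ioo (P := fun σ => ‖g σ‖ ≤
        8829 * (t - σ) ^ (-(1 / 2 : ℝ)) * (4 * N ^ 2)) hgb).mono fun σ hσ hσI => ?_
      exact hσ hσI
  -- Step 1: FTC on `[s, t']`
  have hftc : ∀ t' ∈ Ico s t, Ψ t' = Ψ s - ∫ σ in s..t', g σ := by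
    intro t' ht'
    have hderiv : ∀ x ∈ uIcc s t', HasDerivAt Ψ (-g x) x := by
      intro x hx
      rw [uIcc_of_le ht'.1] at hx
      exact h.hasDerivAt_movingFrame hE (s₀ := s / 2) (half_pos hs) (by linarith [hx.1])
        (hx.2.trans_lt ht'.2) htT y
    have hint : IntervalIntegrable (fun x => -g x) volume s t' :=
      ((hgc.mono (Icc_subset_Ico_right ht'.2)).intervalIntegrable_of_Icc ht'.1).neg
    have := intervalIntegral.integral_eq_sub_of_hasDerivAt hderiv hint
    rw [intervalIntegral.integral_neg] at this
    rw [← sub_eq_zero]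
    have e1 : Ψ t' - (Ψ s - ∫ σ in s..t', g σ) = (Ψ t' - Ψ s) + ∫ σ in s..t', g σ := by abel
    rw [e1, ← this, neg_add_cancel]
  -- Step 2: the limit `t' ↑ t` of the left-hand side
  have hlhs : Tendsto Ψ (𝓝[<] t) (𝓝 (U t (y + B t))) := by
    have hrep : ∀ t' ∈ Ioo 0 t, Ψ t' = U t (y + B t') + driftDuhamel U b t' t (y + B t') := by
      intro t' ht'
      simp only [hΨ]
      rw [h.mild t' t ht'.1 ht'.2 htT (y + B t')]
      abel
    have h1 : Tendsto (fun t' => U t (y + B t')) (𝓝[<] t) (𝓝 (U t (y + B t))) :=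
      (((h.continuous_slice hE ⟨hs.trans hst, htT⟩).comp (continuous_const.add hBc)).tendsto t).mono_left
        nhdsWithin_le_nhds
    have h2 : Tendsto (fun t' => driftDuhamel U b t' t (y + B t')) (𝓝[<] t) (𝓝 0) := by
      rw [tendsto_zero_iff_norm_tendsto_zero]
      have hw : Tendsto (fun t' : ℝ => 70632 * N ^ 2 * (t - t') ^ (1 / 2 : ℝ)) (𝓝[<] t) (𝓝 0) := by
        have hc : Continuous fun t' : ℝ => 70632 * N ^ 2 * (t - t') ^ (1 / 2 : ℝ) :=
          continuous_const.mul ((continuous_const.sub continuous_id).rpow_const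
            fun _ => Or.inr (by norm_num))
        have := hc.tendsto t
        rw [sub_self, Real.zero_rpow (by norm_num), mul_zero] at this
        exact this.mono_left nhdsWithin_le_nhds
      refine squeeze_zero' (Eventually.of_forall fun _ => norm_nonneg _) ?_ hw
      filter_upwards [Ioo_mem_nhdsLT hst] with t' ht'
      exact h.norm_driftDuhamel_le hE (hs.trans ht'.1).le ht'.2.le htT.le _
    have h12 := h1.add h2
    rw [add_zero] at h12
    refine h12.congr' ?_
    filter_upwards [Ioo_mem_nhdsLT hst] with t' ht'
    exact (hrep t' ⟨hs.trans ht'.1, ht'.2⟩).symm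
  -- Step 3: the limit of the right-hand side
  have hrhs : Tendsto (fun t' => Ψ s - ∫ σ in s..t', g σ) (𝓝[<] t)
      (𝓝 (Ψ s - ∫ σ in s..t, g σ)) := by
    have hprim : ContinuousOn (fun t' => ∫ σ in s..t', g σ) (uIcc s t) :=
      intervalIntegral.continuousOn_primitive_interval' hgi left_mem_uIcc
    have hcw : ContinuousWithinAt (fun t' => ∫ σ in s..t', g σ) (Ioo s t) t :=
      (hprim t (right_mem_uIcc)).mono (by rw [uIcc_of_le hst.le]; exact Ioo_subset_Icc_self)
    have : Tendsto (fun t' => ∫ σ in s..t', g σ) (𝓝[<] t) (𝓝 (∫ σ in s..t, g σ)) := by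
      rw [← nhdsWithin_Ioo_eq_nhdsLT hst]
      exact hcw
    exact tendsto_const_nhds.sub this
  -- conclude by uniqueness of limits
  have heq : Ψ =ᶠ[𝓝[<] t] fun t' => Ψ s - ∫ σ in s..t', g σ := by
    filter_upwards [Ico_mem_nhdsLT hst] with t' ht'
    exact hftc t' ht'
  exact tendsto_nhds_unique (hlhs.congr' heq) hrhs

end IsKNSSDriftMild

end MovingFrame

/-! ### Translation covariance of the caloric extension and of the Oseen–heat operator -/

section Translation

variable {E : Type*} [NormedAddCommGroup E] [InnerProductSpace ℝ E] [FiniteDimensional ℝ E]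
  [MeasurableSpace E] [BorelSpace E]
variable {F' : Type*} [NormedAddCommGroup F'] [NormedSpace ℝ F']

/-- **Translation covariance of the caloric extension**: `e^{τΔ}(g(· + c))(x) = e^{τΔ}g (x + c)`
(exact, junk values included: the convolution integrands coincide pointwise). [folklore] -/
theorem heatExtension_comp_add_right_apply (g : E → F') (c : E) (τ : ℝ) (x : E) :
    UnboundedOperators.heatExtension (fun w => g (w + c)) τ x =
      UnboundedOperators.heatExtension g τ (x + c) := by
  rw [UnboundedOperators.heatExtension_apply, UnboundedOperators.heatExtension_apply]
  refine integral_congr_ae (Eventually.of_forall fun v => ?_)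
  simp only [add_sub_right_comm x c v]

/-- Translation covariance of the caloric extension, as functions. [folklore] -/
theorem heatExtension_comp_add_right_fun (g : E → F') (c : E) (τ : ℝ) :
    UnboundedOperators.heatExtension (fun w => g (w + c)) τ =
      fun x => UnboundedOperators.heatExtension g τ (x + c) :=
  funext fun x => heatExtension_comp_add_right_apply g c τ x

/-- Translation covariance of `heatD1`. [folklore] -/
theorem heatD1_comp_add_right (φ : E → ℝ) (c : E) (τ : ℝ) (v x : E) :
    heatD1 τ v (fun w => φ (w + c)) x = heatD1 τ v φ (x + c) := by
  unfold heatD1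
  rw [heatExtension_comp_add_right_fun φ c τ, fderiv_comp_add_right]

/-- Translation covariance of `heatD3`. [folklore] -/
theorem heatD3_comp_add_right (φ : E → ℝ) (c : E) (τ : ℝ) (u v w x : E) :
    heatD3 τ u v w (fun z => φ (z + c)) x = heatD3 τ u v w φ (x + c) := by
  unfold heatD3
  rw [heatExtension_comp_add_right_fun φ c τ]
  have e1 : (fun y => fderiv ℝ (fun x => UnboundedOperators.heatExtension φ τ (x + c)) y w) =
      fun y => fderiv ℝ (UnboundedOperators.heatExtension φ τ) (y + c) w := by
    funext y; rw [fderiv_comp_add_right]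
  rw [e1]
  have e2 : (fun z => fderiv ℝ (fun y => fderiv ℝ (UnboundedOperators.heatExtension φ τ) (y + c) w) z v) =
      fun z => fderiv ℝ (fun y => fderiv ℝ (UnboundedOperators.heatExtension φ τ) y w) (z + c) v := by
    funext z
    rw [fderiv_comp_add_right (f := fun y => fderiv ℝ (UnboundedOperators.heatExtension φ τ) y w)]
  rw [e2, fderiv_comp_add_right (f := fun z => fderiv ℝ
    (fun y => fderiv ℝ (UnboundedOperators.heatExtension φ τ) y w) z v)]

/-- **Translation covariance of the Oseen–heat operator**:
`𝒩_τ[F(· + c)]ᵢ(x) = 𝒩_τ[F]ᵢ(x + c)` (exact). [folklore] -/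
theorem oseenHeat_comp_add_right (F : Fin (Module.finrank ℝ E) → Fin (Module.finrank ℝ E) → E → ℝ)
    (c : E) (τ : ℝ) (i : Fin (Module.finrank ℝ E)) (x : E) :
    oseenHeat τ (fun j k w => F j k (w + c)) i x = oseenHeat τ F i (x + c) := by
  unfold oseenHeat
  simp_rw [heatD1_comp_add_right, heatD3_comp_add_right]

omit [FiniteDimensional ℝ E] [MeasurableSpace E] [BorelSpace E] in
/-- Test functions are translation invariant. [folklore] -/
theorem isTestFunctionOn_top_comp_sub (θ : E → ℝ)
    (hθ : FunctionSpaces.IsTestFunctionOn (⊤ : Opens E) θ) (c : E) :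
    FunctionSpaces.IsTestFunctionOn (⊤ : Opens E) fun v => θ (v - c) where
  contDiff := hθ.contDiff.comp (contDiff_id.sub contDiff_const)
  hasCompactSupport := by
    simpa [sub_eq_add_neg, Function.comp_def] using
      hθ.hasCompactSupport.comp_homeomorph (Homeomorph.addRight (-c))
  tsupport_subset := by simp

/-- **Weak divergence-freeness is translation invariant**: `U(· + c)` is weakly divergence free
when `U` is (test against `θ(· − c)`). [folklore] -/
theorem IsWeaklyDivFree.comp_add_right' {U : E → E} (hU : IsWeaklyDivFree U) (c : E) :
    IsWeaklyDivFree fun w => U (w + c) := by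
  haveI : CompleteSpace E := FiniteDimensional.complete ℝ E
  intro θ hθ
  have key := hU (fun v => θ (v - c)) (isTestFunctionOn_top_comp_sub θ hθ c)
  have hg : ∀ v, gradient (fun v => θ (v - c)) v = gradient θ (v - c) := fun v => by
    simp only [gradient, fderiv_comp_sub_right]
  simp_rw [hg] at key
  rw [← integral_add_right_eq_self (fun v => ⟪U v, gradient θ (v - c)⟫) c] at key
  simpa using key

end Translation

/-! ### Galilean covariance of the drift-mild class -/

section Covariance

variable {E : Type*} [NormedAddCommGroup E] [InnerProductSpace ℝ E] [FiniteDimensional ℝ E]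
  [MeasurableSpace E] [BorelSpace E]

/-- **Galilean covariance of KNSS's drift-mild formulation, in dimension three** (discharge of
the named proposition `IsKNSSDriftMild.GalileanCovariance` of `KNSSRegularityGalilean` for every
three-dimensional `E`): if `(U, b)` is drift-mild on `(0, T)` with bound `N`, then the co-moving
field `Ū(t, y) = U(t, y + B(t))`, `B = ∫₀ b`, is drift-mild with zero drift and the same bound,
i.e. a bounded mild solution of Navier–Stokes restarted at every `s`:
`Ū(t) = e^{(t−s)Δ}Ū(s) − ∫ₛᵗ e^{(t−σ)Δ}P∇·(Ū⊗Ū)(σ) dσ`. Proof: `apply_add_driftPath_eq` (the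
moving-frame identity), made covariant by `heatExtension_comp_add_right_apply` and
`oseenHeat_comp_add_right`; the remaining clauses are translation invariance of the bound, of
joint measurability (the shear `(t, y) ↦ (t, y + B(t))` is measurable) and of weak
divergence-freeness. [folklore] -/
theorem IsKNSSDriftMild.galileanCovariance_of_finrank_eq_three (hE : Module.finrank ℝ E = 3) :
    IsKNSSDriftMild.GalileanCovariance E := by
  intro T N U b h
  have hN : 0 ≤ N := h.nonneg
  have hbm : AEStronglyMeasurable b volume := h.measurable_drift.aestronglyMeasurable
  have hbN := h.norm_drift_le
  have hBc : Continuous (driftPath b) := continuous_driftPath hbm hbN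
  refine
    { measurable_drift := measurable_const
      norm_drift_le := fun t => by simpa using hN
      measurable := ?_
      norm_le := fun t ht x => by simpa [galileanShift] using h.norm_le t ht (x + driftPath b t)
      ae_isWeaklyDivFree := ?_
      mild := fun s t hs hst ht y => ?_ }
  · -- joint measurability: compose with the measurable shear
    have hshear : Measurable fun q : ℝ × E => (q.1, q.2 + driftPath b q.1) :=
      measurable_fst.prodMk (measurable_snd.add (hBc.measurable.comp measurable_fst))
    have : uncurry (galileanShift U b) = uncurry U ∘ fun q : ℝ × E => (q.1, q.2 + driftPath b q.1) := by
      funext q; rfl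
    rw [this]
    exact h.measurable.comp hshear
  · filter_upwards [h.ae_isWeaklyDivFree] with t ht
    exact ht.comp_add_right' (driftPath b t)
  · -- the zero-drift identity
    have key := h.apply_add_driftPath_eq hE hs hst ht y
    simp only [galileanShift_apply]
    rw [key]
    congr 1
    · -- the caloric term
      exact (heatExtension_comp_add_right_apply (U s) (driftPath b s) (t - s) y).symm
    · -- the Duhamel term
      rw [driftDuhamel_apply]
      refine intervalIntegral.integral_congr fun σ _ => ?_
      refine Finset.sum_congr rfl fun i _ => ?_
      congr 1
      have hdata : driftTensor (galileanShift U b) 0 σ =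
          fun j k w => driftTensor U 0 σ j k (w + driftPath b σ) := by
        funext j k w
        simp [driftTensor, galileanShift]
      rw [hdata, oseenHeat_comp_add_right]

/-- **Galilean covariance of the drift-mild class on `ℝ³`** — the instance consumed by
`KNSS2009_driftMild_regularity_of_mild`. [folklore] -/
theorem IsKNSSDriftMild.galileanCovariance_R3 :
    IsKNSSDriftMild.GalileanCovariance (EuclideanSpace ℝ (Fin 3)) :=
  IsKNSSDriftMild.galileanCovariance_of_finrank_eq_three (by simp)

/-- **KNSS's §4 regularity for drift-mild pairs from the regularity of bounded mild solutions**,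
the Galilean hypothesis of `KNSS2009_driftMild_regularity_of_mild` now discharged:
`KNSS2009_mild_regularity → KNSS2009_driftMild_regularity`. [cite: KochNadirashviliSereginSverak2009, §4 (4.8)–(4.11) with Lemma 3.1 (arXiv:0709.3599v1 pp. 7–8)] -/
theorem KNSS2009_driftMild_regularity_of_mild' (hreg : KNSS2009_mild_regularity) :
    KNSS2009_driftMild_regularity :=
  KNSS2009_driftMild_regularity_of_mild IsKNSSDriftMild.galileanCovariance_R3 hreg

/-- **The window regularity fact from Lemma 3.1 and the regularity of bounded mild solutions.**
[cite: KochNadirashviliSereginSverak2009, §4 closing paragraph with Lemma 3.1 and Prop. 4.1 (arXiv:0709.3599v1 pp. 7–8)] -/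
theorem KNSS2009_regularity_boundedWeak_window_of_mild' (h31 : KNSS2009_weak_driftMild)
    (hreg : KNSS2009_mild_regularity) : KNSS2009_regularity_boundedWeak_window :=
  KNSS2009_regularity_boundedWeak_window_of_mild h31 IsKNSSDriftMild.galileanCovariance_R3 hreg

/-- **The ancient regularity fact** (`KNSS2009_regularity_boundedWeak_ancient`, the §4 input of
the proofs of KNSS's Theorems 5.2–5.3) **from Lemma 3.1 and the regularity of bounded mild
solutions**. [cite: KochNadirashviliSereginSverak2009, §5 proof of Thm 5.2, first sentence (arXiv:0709.3599v1 p. 10), with §4 and Lemma 3.1] -/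
theorem KNSS2009_regularity_boundedWeak_ancient_of_mild' (h31 : KNSS2009_weak_driftMild)
    (hreg : KNSS2009_mild_regularity) : KNSS2009_regularity_boundedWeak_ancient :=
  KNSS2009_regularity_boundedWeak_ancient_of_mild h31 IsKNSSDriftMild.galileanCovariance_R3 hreg

end Covariance

end Literature.Analysis.FluidPDE

end
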